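import Summits.AtomisticToContinuum.Crystallization.Theses.GappedShellCensus
import Literature.Probability.Process.LocalRubberCompact
import Literature.Probability.Process.LocalRubberHardCore
import Literature.MathematicalPhysics.StatisticalMechanics.BallMatchLocallyMatches
import Literature.MathematicalPhysics.StatisticalMechanics.LocalMatchingCompactness
import Summits.AtomisticToContinuum.Crystallization.Theorems.PalmUnimodularRigidityChargedPatternCrystallizes

/-!
# Sketch (crux-ideate, ideator 2, round 1) — `CleanLimitExtractionR` (stmt-AtomisticToContinuum-18072)

Crux (route `GappedShellCensus`, rank 9, the repaired bridge):
`CleanLimitExtractionR := RadialDefectsVanish → ShellTrichotomy → TornFree → FiveFoldRationingR →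
CleanLocalLimit`.

STATUS (2026-08-17 ~01:45Z, farm rc 0, 0 `sorry`, axioms propext / Classical.choice / Quot.sound for
both compositions): this workfile contains TWO COMPLETE CANDIDATE PROOFS of the crux, one per crux-idea
card of ideator 2 — `cleanLimitExtractionR_candidate` (card 1) and `cleanLimitExtractionR_via_counts`
(card 2), both audited `proof-of-item … closed: true` against the rev-5 route file.

* **Card 1 `trichotomy-input-factor`** — the bridge FACTORS through the pattern-typed rationing
  statement `GappedRationing` (an all-gapped-twelve non-empty `Y` has fcc/hcp-clean balls of every
  radius): `CleanLimitExtractionR = cleanLimitExtraction_via_hull ∘ gappedRationing_of_trichotomy`.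
  The first factor (`GappedRationing → RadialDefectsVanish → CleanLocalLimit`, the ω-limit-hull
  extraction in the compact rubber space `LocalConfig E3`) is COPIED VERBATIM from the kernel-checked
  workfile of the pre-repair crux, `Cruxes/CleanLimitExtraction/SketchIdeator2.lean` (commit
  7c621bb55b8a, farm rc 0 on 2026-08-17T00:30Z), minus its two census-specific declarations
  (`gappedRationing_of_census`, `cleanLimitExtraction_sketch`, which mention the DROPPED decls
  `ShellCensus` / `CleanLimitExtraction` and no longer elaborate against the rev-5 route file).
  The second factor is NEW and is the whole content of the repair at the bridge:
  `rescaledShell_hyps` (the rescaled shell of a gapped site with admissible shell satisfies the three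
  typing hypotheses of `ShellTrichotomy`), `shellDegree_eq_commonNbrs` (shell-degree of a shell
  point = common-neighbour count of the bond), `fccHcpShell_of_exactFour` (trichotomy + all bonds
  exactly four ⇒ branch (A)), `gappedRationing_of_trichotomy` (TornFree `≥ 4` + FiveFoldRationingR
  `≤ 4` on balls ⇒ exactly four ⇒ (A) on balls), and the crux BY NAME
  `cleanLimitExtractionR_candidate : CleanLimitExtractionR`.
* **Card 2 `bond-graph-transport`** — transport through the limits only the trichotomy's INPUT
  (gapped-twelve + admissible shell + all shell-degrees four: the site predicate `ShellClean`, data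
  of the bond graph protected by the Hales collar), never its OUTPUT (metric typing modulo `O(3)`);
  instantiate the PROVED predicate-generic `clean_extraction_schema` with `Clean := ShellClean a`
  and apply the trichotomy ONCE, pointwise, after all limits.  First lemma: `shellClean_transfer`
  (collar transfer of the bond graph on the shell, finite) ⇒ `shellClean_of_tendsto` (sitewise
  closedness of `ShellClean` along rubber limits, no radius loss) — PROVED; composition
  `cleanLimitExtractionR_via_counts : CleanLimitExtractionR` is kernel-checked and sorry-free; its
  cone never touches `cleanSite_of_tendsto` / `stage_labelling` / `shellCloseTo_of_frequently` /
  `exists_subseq_tendsto_linearIsometry` (see the companion `SketchCountsIdeator2.lean`, which drops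
  them and the `PalmUnimodularRigidityChargedPatternCrystallizes` import altogether).
-/

noncomputable section

open Filter Topology Set
open scoped omegaLimit Classical

namespace Summit.AtomisticToContinuum.Crystallization.Cruxes.CleanLimitExtractionR.IdeatorTwo

open Literature.Probability.Process Literature.MathematicalPhysics.StatisticalMechanics
  Literature.Geometry.DiscreteGeometry
open Summit.AtomisticToContinuum.Crystallization.Theses.GappedShellCensus

/-- Euclidean 3-space. -/
abbrev E3 := EuclideanSpace ℝ (Fin 3)

/-! ## The route's inlined site predicates, named -/

/-- GAPPED-TWELVE at scale `a` (literally the route's clause for a site `y` of `Y`). -/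
def GappedTwelve (a : ℝ) (Y : Set E3) (y : E3) : Prop :=
  {w ∈ Y | w ≠ y ∧ dist y w ≤ a * (1 + 1 / 50)}.ncard = 12 ∧
    ∀ w ∈ Y, w ≠ y → a * (1 - 1 / 50) ≤ dist y w ∧
      (dist y w ≤ a * (1 + 1 / 50) ∨ a * (63 / 50) ≤ dist y w)

/-- The rescaled bond shell of `y` is `1/5`-close to fcc or hcp (the route's typing clause). -/
def FccHcpShell (a : ℝ) (Y : Set E3) (y : E3) : Prop :=
  ∃ T : Finset E3, (↑T : Set E3) = (fun w => a⁻¹ • (w - y)) '' {w ∈ Y | w ≠ y ∧ dist y w ≤ a * (1 + 1 / 50)} ∧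
    (ShellCloseTo (1 / 5) T fccKissingPattern ∨ ShellCloseTo (1 / 5) T hcpKissingPattern)

/-- CLEAN site = gapped-twelve with fcc/hcp-close shell (the conjunct of `CleanLocalLimit`). -/
def CleanSite (a : ℝ) (Y : Set E3) (y : E3) : Prop :=
  GappedTwelve a Y y ∧ FccHcpShell a Y y

/-- The ALPHABET-FREE rationing (FiveFoldRationing with its typing hypothesis discharged by the
census; the refuter's `GappedRationing`, restated here since Helper.lean is not importable):
an all-gapped-twelve non-empty `Y` has fcc/hcp-clean balls of every radius. -/
def GappedRationing : Prop :=
  ∀ (Y : Set E3) (a : ℝ), 0 < a → Y.Nonempty → (∀ y ∈ Y, GappedTwelve a Y y) →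
    ∀ R : ℝ, ∃ c ∈ Y, ∀ y ∈ Y, dist y c ≤ R → FccHcpShell a Y y

/-! ## Card A — the hull as a Mathlib ω-limit set in the compact rubber space `LocalConfig E3` -/

/-- The `N`-th cluster as a point configuration. -/
def cfg (x : (N : ℕ) → (Fin N → E3)) (N : ℕ) : LocalConfig E3 := ⟨Set.range (x N)⟩

/-- The HULL of a sequence of finite configurations: the ω-limit, as the particle number
`N → ∞` (`Filter.atTop`), of the family of ALL re-rootings `(cfg x N).translate t`, `t ∈ ℝ³`, in
the compact pseudometric space `LocalConfig E3` of the local rubber topology: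
`hull x = ⋂_{N₀} closure {(cfg x N).translate t | N ≥ N₀, t}`. -/
def hull (x : (N : ℕ) → (Fin N → E3)) : Set (LocalConfig E3) :=
  ω atTop (fun N (t : E3) => (cfg x N).translate t) univ

variable {x : (N : ℕ) → (Fin N → E3)} {Y : LocalConfig E3}

/-- The hull is closed — Mathlib `isClosed_omegaLimit`. PROVED. -/
theorem isClosed_hull (x : (N : ℕ) → (Fin N → E3)) : IsClosed (hull x) :=
  isClosed_omegaLimit _ _ _

/-- The hull is invariant under re-rooting — Mathlib `mapsTo_omegaLimit` with the continuous map
`translate · y` (`LocalConfig.continuous_translate`) and `translate_translate`. PROVED: this and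
`isClosed_hull` REPLACE the diagonal argument (closure of the orbit of a hull element ⊆ hull). -/
theorem translate_mem_hull (hY : Y ∈ hull x) (y : E3) : Y.translate y ∈ hull x := by
  have h := mapsTo_omegaLimit (f := atTop) (ϕ := fun N (t : E3) => (cfg x N).translate t)
    (ϕ' := fun N (t : E3) => (cfg x N).translate t) (s := univ) (s' := univ)
    (ga := fun t => y + t) (mapsTo_univ _ _) (gb := fun S : LocalConfig E3 => S.translate y)
    (fun N t => LocalConfig.translate_translate _ _ _) (LocalConfig.continuous_translate y)
  exact h hY

/-- Closure of the re-rooting orbit of a hull element stays in the hull (corollary; no indices). -/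
theorem closure_orbit_subset_hull (hY : Y ∈ hull x) :
    closure (Set.range fun y : E3 => Y.translate y) ⊆ hull x :=
  closure_minimal (by rintro _ ⟨y, rfl⟩; exact translate_mem_hull hY y) (isClosed_hull x)

/-- Limits of re-rooted clusters along a subsequence lie in the hull (definition of `ω`). PROVED. -/
theorem mem_hull_of_tendsto {φ : ℕ → ℕ} (hφ : StrictMono φ) (t : ℕ → E3)
    (h : Tendsto (fun k => (cfg x (φ k)).translate (t k)) atTop (𝓝 Y)) : Y ∈ hull x := by
  simp only [hull, omegaLimit_def, mem_iInter]
  intro u hu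
  refine mem_closure_of_tendsto h ?_
  have hev : ∀ᶠ k in atTop, φ k ∈ u := hφ.tendsto_atTop.eventually hu
  filter_upwards [hev] with k hk
  exact mem_image2_of_mem hk (mem_univ _)

/-- DICTIONARY, sequential form (FIRST LEMMA of card A): a member of the hull is the limit of
re-rooted clusters along a STRICTLY INCREASING subsequence of THE GIVEN `x`
(`mem_omegaLimit_iff_frequently` + metric balls + `Filter.extraction_forall_of_frequently`). PROVED. -/
theorem exists_seq_of_mem_hull (hY : Y ∈ hull x) :
    ∃ (φ : ℕ → ℕ) (t : ℕ → E3), StrictMono φ ∧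
      Tendsto (fun k => (cfg x (φ k)).translate (t k)) atTop (𝓝 Y) := by
  have hfr : ∀ k : ℕ, ∃ᶠ N in atTop, ∃ t : E3,
      dist ((cfg x N).translate t) Y < 1 / ((k : ℝ) + 1) := by
    intro k
    have h := (mem_omegaLimit_iff_frequently _ _ _ Y).1 hY (Metric.ball Y (1 / ((k : ℝ) + 1)))
      (Metric.ball_mem_nhds _ (by positivity))
    refine h.mono fun N hN => ?_
    obtain ⟨t, -, ht⟩ := hN
    exact ⟨t, Metric.mem_ball.1 ht⟩
  obtain ⟨φ, hφ, hP⟩ := extraction_forall_of_frequently hfr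
  choose t ht using hP
  refine ⟨φ, t, hφ, ?_⟩
  rw [Metric.tendsto_atTop]
  intro ε hε
  obtain ⟨K, hK⟩ := exists_nat_one_div_lt hε
  refine ⟨K, fun k hk => lt_of_lt_of_le (ht k) ?_⟩
  have hk' : (K : ℝ) + 1 ≤ (k : ℝ) + 1 := by
    have : (K : ℝ) ≤ k := by exact_mod_cast hk
    linarith
  have : (1 : ℝ) / ((k : ℝ) + 1) ≤ 1 / ((K : ℝ) + 1) :=
    one_div_le_one_div_of_le (by positivity) hk'
  linarith

/-- DICTIONARY, matching form: convergence of re-rooted clusters IS the two-way matching clause of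
`CleanLocalLimit` (`LocalConfig.tendsto_iff_locallyMatches`; translation `τ n = -t n`). PROVED. -/
theorem cll_clause_of_tendsto {φ : ℕ → ℕ} {t : ℕ → E3}
    (h : Tendsto (fun k => (cfg x (φ k)).translate (t k)) atTop (𝓝 Y)) :
    ∀ R ε : ℝ, 0 < ε → ∀ᶠ n in atTop,
      (∀ y ∈ (Y : Set E3), ‖y‖ ≤ R → ∃ i : Fin (φ n), dist (x (φ n) i + -t n) y ≤ ε) ∧
      (∀ i : Fin (φ n), ‖x (φ n) i + -t n‖ ≤ R →
        ∃ y ∈ (Y : Set E3), dist (x (φ n) i + -t n) y ≤ ε) := by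
  intro R ε hε
  filter_upwards [LocalConfig.tendsto_iff_locallyMatches.1 h R ε hε] with n hn
  obtain ⟨h1, h2⟩ := hn
  have hmem : ∀ i : Fin (φ n), x (φ n) i + -t n ∈ ((cfg x (φ n)).translate (t n) : Set E3) := by
    intro i
    simp only [cfg, LocalConfig.coe_translate, LocalConfig.coe_mk]
    exact ⟨x (φ n) i, ⟨i, rfl⟩, sub_eq_add_neg _ _⟩
  refine ⟨fun y hy hyR => ?_, fun i hi => ?_⟩
  · obtain ⟨p, hp, hyp⟩ := h2 y hy hyR
    simp only [cfg, LocalConfig.coe_translate, LocalConfig.coe_mk] at hp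
    obtain ⟨z, ⟨i, rfl⟩, rfl⟩ := hp
    exact ⟨i, by rw [← sub_eq_add_neg, dist_comm]; exact hyp⟩
  · obtain ⟨q, hq, hqp⟩ := h1 (x (φ n) i + -t n) (hmem i) hi
    exact ⟨q, hq, by rw [dist_comm]; exact hqp⟩

/- (The crux-level statements `exists_clean_rooted_mem_hull`, `cleanLimitExtraction_via_hull`,
`cleanLimitExtraction_sketch` of card A are at the END of the file, after the closedness lemmas
they use.) -/

/-! ## Card C — the Hales gap makes shell counts continuous: collar transfer -/

/-- FIRST LEMMA of card C: COLLAR TRANSFER (finite, limit-free). Two `δ`-separated configurations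
that are two-way `(R, η)`-matched with `2η < δ` have the SAME gapped-twelve status at matched sites,
provided the second one is radially admissible there: the matching restricts to a bijection of the
two bond shells because their boundary spheres `0.98a`, `1.02a` sit inside particle-free collars
(the hard-core moat below `0.98a` and the Hales gap `(1.02a, 1.26a)`), both wider than `2η`.
PROVED. -/
theorem gappedTwelve_transfer {S S' : Set E3} {a δ η R : ℝ} (ha : 0 < a) (hδ : 0 < δ)
    (hη : 0 ≤ η) (h2η : 2 * η < δ) (hηa : 25 * η < a)
    (hS : ∀ u ∈ S, ∀ v ∈ S, u ≠ v → δ ≤ dist u v)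
    (hS' : ∀ u ∈ S', ∀ v ∈ S', u ≠ v → δ ≤ dist u v)
    (hm : LocallyMatches R η S S') {p p' : E3} (hp : p ∈ S) (hp' : p' ∈ S')
    (hpp' : dist p p' ≤ η) (hR : ‖p‖ + 2 * a ≤ R)
    (hg : GappedTwelve a S p)
    (hrad : ∀ w ∈ S', w ≠ p' → a * (1 - 1 / 50) ≤ dist p' w ∧
      (dist p' w ≤ a * (1 + 1 / 50) ∨ a * (63 / 50) ≤ dist p' w)) :
    GappedTwelve a S' p' := by
  obtain ⟨hcount, hradS⟩ := hg
  refine ⟨?_, hrad⟩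
  set A : Set E3 := {w ∈ S | w ≠ p ∧ dist p w ≤ a * (1 + 1 / 50)} with hA
  set B : Set E3 := {w ∈ S' | w ≠ p' ∧ dist p' w ≤ a * (1 + 1 / 50)} with hB
  -- both shells are finite (separated subsets of closed balls)
  have hAfin : A.Finite := by
    refine finite_of_forall_le_dist_of_subset_closedBall hδ
      (fun u hu v hv huv => hS u hu.1 v hv.1 huv) (c := p) (R := a * (1 + 1 / 50)) ?_
    intro w hw
    exact Metric.mem_closedBall.2 (by rw [dist_comm]; exact hw.2.2)
  have hBfin : B.Finite := by
    refine finite_of_forall_le_dist_of_subset_closedBall hδ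
      (fun u hu v hv huv => hS' u hu.1 v hv.1 huv) (c := p') (R := a * (1 + 1 / 50)) ?_
    intro w hw
    exact Metric.mem_closedBall.2 (by rw [dist_comm]; exact hw.2.2)
  have hpp'' : dist p' p ≤ η := by rw [dist_comm]; exact hpp'
  -- shell of `p` in `S` ↦ shell of `p'` in `S'`
  have hAto : ∀ w ∈ A, ∃ w' ∈ B, dist w w' ≤ η := by
    intro w hw
    obtain ⟨hwS, hwp, hdw⟩ := hw
    have hwR : ‖w‖ ≤ R := by
      have h1 := norm_sub_norm_le w p
      rw [← dist_eq_norm, dist_comm] at h1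
      nlinarith [ha]
    obtain ⟨w', hw'S, hww'⟩ := hm.2 w hwS hwR
    have hlow : a * (1 - 1 / 50) ≤ dist p w := (hradS w hwS hwp).1
    have hne : w' ≠ p' := by
      intro h
      rw [h] at hww'
      have : dist p w ≤ dist p p' + dist w p' := dist_triangle_right p w p'
      nlinarith [ha]
    have hup : dist p' w' ≤ a * (1 + 1 / 50) + 2 * η :=
      calc dist p' w' ≤ dist p' p + dist p w' := dist_triangle _ _ _
        _ ≤ dist p' p + (dist p w + dist w w') := by gcongr; exact dist_triangle _ _ _
        _ ≤ η + (a * (1 + 1 / 50) + η) := by gcongr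
        _ = a * (1 + 1 / 50) + 2 * η := by ring
    refine ⟨w', ⟨hw'S, hne, ?_⟩, hww'⟩
    rcases (hrad w' hw'S hne).2 with h | h
    · exact h
    · exfalso; nlinarith [ha]
  -- shell of `p'` in `S'` ↦ shell of `p` in `S`
  have hBto : ∀ w' ∈ B, ∃ w ∈ A, dist w w' ≤ η := by
    intro w' hw'
    obtain ⟨hw'S, hw'p, hdw'⟩ := hw'
    have hw'R : ‖w'‖ ≤ R := by
      have h1 := norm_sub_norm_le w' p'
      rw [← dist_eq_norm, dist_comm] at h1
      have h2 := norm_sub_norm_le p' p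
      rw [← dist_eq_norm] at h2
      nlinarith [ha]
    obtain ⟨w, hwS, hww'⟩ := hm.1 w' hw'S hw'R
    have hlow : a * (1 - 1 / 50) ≤ dist p' w' := (hrad w' hw'S hw'p).1
    have hne : w ≠ p := by
      intro h
      rw [h] at hww'
      have : dist p' w' ≤ dist p' p + dist p w' := dist_triangle _ _ _
      nlinarith [ha]
    have hup : dist p w ≤ a * (1 + 1 / 50) + 2 * η :=
      calc dist p w ≤ dist p p' + dist p' w := dist_triangle _ _ _
        _ ≤ dist p p' + (dist p' w' + dist w' w) := by gcongr; exact dist_triangle _ _ _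
        _ ≤ η + (a * (1 + 1 / 50) + η) := by gcongr; rw [dist_comm]; exact hww'
        _ = a * (1 + 1 / 50) + 2 * η := by ring
    refine ⟨w, ⟨hwS, hne, ?_⟩, hww'⟩
    rcases (hradS w hwS hne).2 with h | h
    · exact h
    · exfalso; nlinarith [ha]
  -- the two maps are injective because `2η < δ`
  choose! f hf using hAto
  choose! g hg using hBto
  have hfinj : Set.InjOn f A := by
    intro w₁ h₁ w₂ h₂ heq
    by_contra hne
    have hsep := hS w₁ h₁.1 w₂ h₂.1 hne
    have : dist w₁ w₂ ≤ 2 * η :=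
      calc dist w₁ w₂ ≤ dist w₁ (f w₁) + dist w₂ (f w₁) := dist_triangle_right _ _ _
        _ ≤ η + η := by
            gcongr
            · exact (hf w₁ h₁).2
            · rw [heq]; exact (hf w₂ h₂).2
        _ = 2 * η := by ring
    linarith
  have hginj : Set.InjOn g B := by
    intro w₁ h₁ w₂ h₂ heq
    by_contra hne
    have hsep := hS' w₁ h₁.1 w₂ h₂.1 hne
    have : dist w₁ w₂ ≤ 2 * η :=
      calc dist w₁ w₂ ≤ dist (g w₁) w₁ + dist (g w₁) w₂ := dist_triangle_left _ _ _
        _ ≤ η + η := by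
            gcongr
            · exact (hg w₁ h₁).2
            · rw [heq]; exact (hg w₂ h₂).2
        _ = 2 * η := by ring
    linarith
  have h1 : A.ncard ≤ B.ncard := Set.ncard_le_ncard_of_injOn f (fun w hw => (hf w hw).1) hfinj hBfin
  have h2 : B.ncard ≤ A.ncard := Set.ncard_le_ncard_of_injOn g (fun w hw => (hg w hw).1) hginj hAfin
  omega

/-- Radial admissibility is CLOSED along local-rubber limits (the allowed distance set
`{0} ∪ [0.98a, 1.02a] ∪ [1.26a, ∞)` is closed) — the cheap half. PROVED. -/
theorem radial_of_tendsto {S : ℕ → LocalConfig E3} {Y : LocalConfig E3} {a δ : ℝ} (ha : 0 < a)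
    (hδ : 0 < δ) (hS : ∀ k, ∀ u ∈ S k, ∀ v ∈ S k, u ≠ v → δ ≤ dist u v)
    (hY : Tendsto S atTop (𝓝 Y)) {y : E3} {r : ℝ} (hy : y ∈ Y) (hyr : ‖y‖ < r)
    (hgood : ∀ᶠ k in atTop, ∀ p ∈ S k, ‖p‖ ≤ r → GappedTwelve a (S k : Set E3) p) :
    ∀ w ∈ (Y : Set E3), w ≠ y → a * (1 - 1 / 50) ≤ dist y w ∧
      (dist y w ≤ a * (1 + 1 / 50) ∨ a * (63 / 50) ≤ dist y w) := by
  intro w hw hne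
  have hyw : 0 < dist y w := dist_pos.2 (Ne.symm hne)
  have hr : 0 < r - ‖y‖ := by linarith
  -- key approximation: at every small scale `η` the distance `dist y w` is `2η`-close to an admissible one
  have key : ∀ η : ℝ, 0 < η → η ≤ r - ‖y‖ → 2 * η < dist y w →
      ∃ d : ℝ, |d - dist y w| ≤ 2 * η ∧ a * (1 - 1 / 50) ≤ d ∧
        (d ≤ a * (1 + 1 / 50) ∨ a * (63 / 50) ≤ d) := by
    intro η hη hηr hη2
    obtain ⟨k, hmatch, hgk⟩ :=
      (((LocalConfig.tendsto_iff_locallyMatches.1 hY) (max ‖y‖ ‖w‖) η hη).and hgood).exists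
    obtain ⟨p, hp, hyp⟩ := hmatch.2 y hy (le_max_left _ _)
    obtain ⟨q, hq, hwq⟩ := hmatch.2 w hw (le_max_right _ _)
    have hpq : p ≠ q := by
      intro h
      rw [h] at hyp
      have : dist y w ≤ dist y q + dist w q := dist_triangle_right _ _ _
      linarith
    have hpnorm : ‖p‖ ≤ r := by
      have h1 := norm_sub_norm_le p y
      rw [← dist_eq_norm, dist_comm] at h1
      linarith
    obtain ⟨-, hradS⟩ := hgk p hp hpnorm
    obtain ⟨hlo, hdisj⟩ := hradS q hq (Ne.symm hpq)
    refine ⟨dist p q, ?_, hlo, hdisj⟩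
    rw [abs_sub_le_iff]
    constructor
    · have : dist p q ≤ dist p y + (dist y w + dist w q) :=
        (dist_triangle p y q).trans (by gcongr; exact dist_triangle _ _ _)
      rw [dist_comm p y] at this
      linarith
    · have : dist y w ≤ dist y p + (dist p q + dist q w) :=
        (dist_triangle y p w).trans (by gcongr; exact dist_triangle _ _ _)
      rw [dist_comm q w] at this
      linarith
  have hlow : a * (1 - 1 / 50) ≤ dist y w := by
    refine le_of_forall_pos_lt_add fun ε hε => ?_
    have hm0 : 0 < min (r - ‖y‖) (min (dist y w / 4) (ε / 4)) :=
      lt_min hr (lt_min (by linarith) (by linarith))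
    have hm1 : min (r - ‖y‖) (min (dist y w / 4) (ε / 4)) ≤ dist y w / 4 :=
      (min_le_right _ _).trans (min_le_left _ _)
    have hm2 : min (r - ‖y‖) (min (dist y w / 4) (ε / 4)) ≤ ε / 4 :=
      (min_le_right _ _).trans (min_le_right _ _)
    obtain ⟨d, hd, hlo, -⟩ := key _ hm0 (min_le_left _ _) (by linarith)
    have h1 := (abs_sub_le_iff.1 hd).1
    linarith
  refine ⟨hlow, ?_⟩
  by_cases hcase : dist y w ≤ a * (1 + 1 / 50)
  · exact Or.inl hcase
  · right
    push Not at hcase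
    refine le_of_forall_pos_lt_add fun ε hε => ?_
    have hgap0 : 0 < dist y w - a * (1 + 1 / 50) := by linarith
    have hm0 : 0 < min (r - ‖y‖) (min (dist y w / 4) (min (ε / 4) ((dist y w - a * (1 + 1 / 50)) / 4))) :=
      lt_min hr (lt_min (by linarith) (lt_min (by linarith) (by linarith)))
    have hm1 : min (r - ‖y‖) (min (dist y w / 4) (min (ε / 4) ((dist y w - a * (1 + 1 / 50)) / 4))) ≤
        dist y w / 4 := (min_le_right _ _).trans (min_le_left _ _)
    have hm2 : min (r - ‖y‖) (min (dist y w / 4) (min (ε / 4) ((dist y w - a * (1 + 1 / 50)) / 4))) ≤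
        ε / 4 := ((min_le_right _ _).trans (min_le_right _ _)).trans (min_le_left _ _)
    have hm3 : min (r - ‖y‖) (min (dist y w / 4) (min (ε / 4) ((dist y w - a * (1 + 1 / 50)) / 4))) ≤
        (dist y w - a * (1 + 1 / 50)) / 4 :=
      ((min_le_right _ _).trans (min_le_right _ _)).trans (min_le_right _ _)
    obtain ⟨d, hd, -, hdisj⟩ := key _ hm0 (min_le_left _ _) (by linarith)
    obtain ⟨h1, h2⟩ := abs_sub_le_iff.1 hd
    rcases hdisj with h | h
    · exfalso
      linarith
    · linarith

/-- GAPPED-TWELVE IS CLOSED under local-rubber limits of `δ`-separated configurations (sitewise,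
with radius loss): `radial_of_tendsto` + `gappedTwelve_transfer` applied to a fine matching
(`tendsto_iff_locallyMatches`). This is hypothesis `hclG` of the schema for `Good := GappedTwelve a`.
PROVED. -/
theorem gappedTwelve_of_tendsto {S : ℕ → LocalConfig E3} {Y : LocalConfig E3} {a δ : ℝ}
    (ha : 0 < a) (hδ : 0 < δ) (hS : ∀ k, ∀ u ∈ S k, ∀ v ∈ S k, u ≠ v → δ ≤ dist u v)
    (hY : Tendsto S atTop (𝓝 Y)) {y : E3} {r : ℝ} (hy : y ∈ Y) (hyr : ‖y‖ < r)
    (hgood : ∀ᶠ k in atTop, ∀ p ∈ S k, ‖p‖ ≤ r → GappedTwelve a (S k : Set E3) p) :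
    GappedTwelve a (Y : Set E3) y := by
  have hrad := radial_of_tendsto ha hδ hS hY hy hyr hgood
  have hr : 0 < r - ‖y‖ := by linarith
  -- the limit is `δ`-separated (closed class)
  have hYsep : ∀ u ∈ Y, ∀ v ∈ Y, u ≠ v → δ ≤ dist u v :=
    (LocalConfig.isClosed_setOf_separated δ).mem_of_tendsto hY (Eventually.of_forall hS)
  -- a fine matching scale
  set η : ℝ := min (δ / 4) (min (a / 50) (min ((r - ‖y‖) / 2) 1)) with hη_def
  have hη : 0 < η := lt_min (by positivity) (lt_min (by positivity) (lt_min (by positivity) one_pos))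
  have hηδ : η ≤ δ / 4 := min_le_left _ _
  have hηa : η ≤ a / 50 := (min_le_right _ _).trans (min_le_left _ _)
  have hηr : η ≤ (r - ‖y‖) / 2 := ((min_le_right _ _).trans (min_le_right _ _)).trans (min_le_left _ _)
  have hη1 : η ≤ 1 := ((min_le_right _ _).trans (min_le_right _ _)).trans (min_le_right _ _)
  obtain ⟨k, hmatch, hgk⟩ :=
    (((LocalConfig.tendsto_iff_locallyMatches.1 hY) (‖y‖ + 1 + 2 * a) η hη).and hgood).exists
  obtain ⟨p, hp, hyp⟩ := hmatch.2 y hy (by linarith)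
  have hpn : ‖p‖ ≤ ‖y‖ + η := by
    have h1 := norm_sub_norm_le p y
    rw [← dist_eq_norm, dist_comm] at h1
    linarith
  have hg : GappedTwelve a (S k : Set E3) p := hgk p hp (by linarith)
  exact gappedTwelve_transfer ha hδ hη.le (by linarith) (by linarith) (hS k) hYsep hmatch.symm hp hy
    (by rw [dist_comm]; exact hyp) (by linarith) hg hrad

/-- Finite-dimensional compactness step, pattern fixed: if injective labellings `g : P → T` with
isometries `A_n` at tolerance `1/5 + ε n` occur frequently and `ε n → 0`, then
`ShellCloseTo (1/5) T P` — pigeonhole on the finitely many `g`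
(`exists_frequently_eq_of_forall_mem`), sequential compactness of O(3)
(`exists_subseq_tendsto_linearIsometry`), closedness of `≤`; the pattern of the landed
`PalmGoodLaw.exists_bijOn_of_frequently`, with `EtaMatched`'s `Equiv` assembled at the end. PROVED. -/
theorem shellCloseTo_of_frequently {T P : Finset E3} (hcard : T.card = P.card) {ε : ℕ → ℝ}
    (hε : Tendsto ε atTop (𝓝 0))
    (h : ∃ᶠ n in atTop, ∃ (g : ↥P → ↥T) (A : E3 →ₗᵢ[ℝ] E3),
      Function.Injective g ∧ ∀ v : ↥P, dist ((g v : ↥T) : E3) (A v) ≤ 1 / 5 + ε n) :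
    ShellCloseTo (1 / 5) T P := by
  classical
  obtain ⟨ψ₀, hψ₀, hall⟩ := extraction_of_frequently_atTop h
  choose g A hginj hdist using hall
  obtain ⟨g₀, -, hfreq⟩ :=
    Summit.AtomisticToContinuum.Crystallization.Theorems.exists_frequently_eq_of_forall_mem
      (F := Finset.univ) (y := g) fun k => Finset.mem_univ _
  obtain ⟨ψ₁, hψ₁, hg₀⟩ := extraction_of_frequently_atTop hfreq
  obtain ⟨ψ₂, hψ₂, B, hB⟩ :=
    Summit.AtomisticToContinuum.Crystallization.Theorems.exists_subseq_tendsto_linearIsometry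
      fun k => A (ψ₁ k)
  have hg₀inj : Function.Injective g₀ := by
    rw [← hg₀ 0]
    exact hginj _
  have hg₀bij : Function.Bijective g₀ := by
    rw [Fintype.bijective_iff_injective_and_card]
    refine ⟨hg₀inj, ?_⟩
    simp only [Fintype.card_coe]
    exact hcard.symm
  -- the displacement bound passes to the limit isometry
  have hlim : ∀ v : ↥P, dist ((g₀ v : ↥T) : E3) (B v) ≤ 1 / 5 := by
    intro v
    have hA : Tendsto (fun k => A (ψ₁ (ψ₂ k)) v) atTop (𝓝 (B v)) := by
      have h1 : Tendsto (fun k => (A (ψ₁ (ψ₂ k))).toContinuousLinearMap) atTop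
          (𝓝 B.toContinuousLinearMap) := hB
      exact ((ContinuousLinearMap.apply ℝ E3 (v : E3)).continuous.tendsto _).comp h1
    have hL : Tendsto (fun k => dist ((g₀ v : ↥T) : E3) (A (ψ₁ (ψ₂ k)) v)) atTop
        (𝓝 (dist ((g₀ v : ↥T) : E3) (B v))) := tendsto_const_nhds.dist hA
    have hR : Tendsto (fun k => 1 / 5 + ε (ψ₀ (ψ₁ (ψ₂ k)))) atTop (𝓝 (1 / 5 + 0)) :=
      tendsto_const_nhds.add (hε.comp ((hψ₀.comp (hψ₁.comp hψ₂)).tendsto_atTop))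
    rw [add_zero] at hR
    refine le_of_tendsto_of_tendsto' hL hR fun k => ?_
    have := hdist (ψ₁ (ψ₂ k)) v
    rw [hg₀ (ψ₂ k)] at this
    exact this
  -- assemble the matching `T ≃ P.image B`
  set eP : ↥P ≃ ↥T := Equiv.ofBijective g₀ hg₀bij with heP
  have hBmem : ∀ v : ↥P, B v ∈ P.image B := fun v => Finset.mem_image_of_mem _ v.2
  set fB : ↥P → ↥(P.image B) := fun v => ⟨B v, hBmem v⟩ with hfB
  have hfBbij : Function.Bijective fB := by
    constructor
    · intro v v' hvv'
      have : (B v : E3) = B v' := congrArg Subtype.val hvv'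
      exact Subtype.ext (B.injective this)
    · rintro ⟨q, hq⟩
      obtain ⟨v, hv, rfl⟩ := Finset.mem_image.1 hq
      exact ⟨⟨v, hv⟩, rfl⟩
  set eB : ↥P ≃ ↥(P.image B) := Equiv.ofBijective fB hfBbij with heB
  refine ⟨B, eP.symm.trans eB, fun t => ?_⟩
  have hgt : g₀ (eP.symm t) = t := eP.apply_symm_apply t
  have h1 := hlim (eP.symm t)
  rw [hgt] at h1
  exact h1

/-- STAGE LABELLING (finite, one matching): from a clean stage site `p` near the limit site `y`,
an injective labelling of the LIMIT shell (rescaled, as the Finset `T`) by the stage's pattern `P`,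
at tolerance `1/5 + 2η/a`: pattern point `v` ↦ stage shell point (via the stage's `EtaMatched`
equivalence) ↦ its partner in `Y` (fine matching; it lies in the shell of `y` by the collar
argument) ↦ rescaled about `y`. PROVED. -/
theorem stage_labelling {S Y : Set E3} {a δ η R : ℝ} (ha : 0 < a) (hδ : 0 < δ) (hη : 0 ≤ η)
    (h2η : 2 * η < δ) (hηa : 25 * η < a) (hη1 : η ≤ 1)
    (hS : ∀ u ∈ S, ∀ v ∈ S, u ≠ v → δ ≤ dist u v)
    (hm : LocallyMatches R η Y S) {p y : E3} (hp : p ∈ S) (hyp : dist y p ≤ η)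
    (hR : ‖y‖ + 1 + 2 * a ≤ R) (hg : GappedTwelve a S p)
    (hrad : ∀ w ∈ Y, w ≠ y → a * (1 - 1 / 50) ≤ dist y w ∧
      (dist y w ≤ a * (1 + 1 / 50) ∨ a * (63 / 50) ≤ dist y w))
    {T Tk P : Finset E3}
    (hT : (↑T : Set E3) = (fun w => a⁻¹ • (w - y)) '' {w ∈ Y | w ≠ y ∧ dist y w ≤ a * (1 + 1 / 50)})
    (hTk : (↑Tk : Set E3) = (fun w => a⁻¹ • (w - p)) '' {w ∈ S | w ≠ p ∧ dist p w ≤ a * (1 + 1 / 50)})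
    (hclose : ShellCloseTo (1 / 5) Tk P) :
    ∃ (g : ↥P → ↥T) (A : E3 →ₗᵢ[ℝ] E3), Function.Injective g ∧
      ∀ v : ↥P, dist ((g v : ↥T) : E3) (A v) ≤ 1 / 5 + 2 * η / a := by
  classical
  obtain ⟨A, e, he⟩ := hclose
  have hAmem : ∀ v : ↥P, A v ∈ P.image A := fun v => Finset.mem_image_of_mem _ v.2
  -- the stage shell point labelled by `v`
  have H1 : ∀ v : ↥P, ∃ wk : E3, (wk ∈ S ∧ wk ≠ p ∧ dist p wk ≤ a * (1 + 1 / 50)) ∧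
      a⁻¹ • (wk - p) = ((e.symm ⟨A v, hAmem v⟩ : ↥Tk) : E3) := by
    intro v
    have hmem : ((e.symm ⟨A v, hAmem v⟩ : ↥Tk) : E3) ∈ (↑Tk : Set E3) :=
      (e.symm ⟨A v, hAmem v⟩).2
    rw [hTk] at hmem
    obtain ⟨wk, hwk, hwk_eq⟩ := hmem
    exact ⟨wk, hwk, hwk_eq⟩
  choose wk hwk hwk_eq using H1
  have hlowk : ∀ v, a * (1 - 1 / 50) ≤ dist p (wk v) := fun v =>
    (hg.2 (wk v) (hwk v).1 (hwk v).2.1).1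
  -- its partner in `Y`
  have H2 : ∀ v : ↥P, ∃ w ∈ Y, dist w (wk v) ≤ η := by
    intro v
    refine hm.1 (wk v) (hwk v).1 ?_
    have h1 := norm_sub_norm_le (wk v) p
    rw [← dist_eq_norm, dist_comm] at h1
    have h2 := norm_sub_norm_le p y
    rw [← dist_eq_norm, dist_comm] at h2
    nlinarith [(hwk v).2.2, ha]
  choose w hwY hw_dist using H2
  -- the partner lies in the shell of `y` (collar argument)
  have hw_ne : ∀ v, w v ≠ y := by
    intro v h
    have h1 : dist y (wk v) ≤ η := by rw [← h]; exact hw_dist v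
    have h2 : dist p (wk v) ≤ dist p y + dist y (wk v) := dist_triangle _ _ _
    rw [dist_comm p y] at h2
    nlinarith [hlowk v, ha]
  have hw_sh : ∀ v, dist y (w v) ≤ a * (1 + 1 / 50) := by
    intro v
    have hup : dist y (w v) ≤ a * (1 + 1 / 50) + 2 * η :=
      calc dist y (w v) ≤ dist y p + dist p (w v) := dist_triangle _ _ _
        _ ≤ dist y p + (dist p (wk v) + dist (wk v) (w v)) := by gcongr; exact dist_triangle _ _ _
        _ ≤ η + (a * (1 + 1 / 50) + η) := by
            gcongr
            · exact (hwk v).2.2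
            · rw [dist_comm]; exact hw_dist v
        _ = a * (1 + 1 / 50) + 2 * η := by ring
    rcases (hrad (w v) (hwY v) (hw_ne v)).2 with h | h
    · exact h
    · exfalso; nlinarith [ha]
  -- the labelling
  have hgmem : ∀ v : ↥P, a⁻¹ • (w v - y) ∈ T := by
    intro v
    rw [← Finset.mem_coe, hT]
    exact ⟨w v, ⟨hwY v, hw_ne v, hw_sh v⟩, rfl⟩
  refine ⟨fun v => ⟨a⁻¹ • (w v - y), hgmem v⟩, A, ?_, ?_⟩
  · intro v v' hvv'
    have h1 : a⁻¹ • (w v - y) = a⁻¹ • (w v' - y) := congrArg Subtype.val hvv'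
    have h2 : w v = w v' :=
      sub_left_injective (smul_right_injective E3 (inv_ne_zero ha.ne') h1)
    have h3 : wk v = wk v' := by
      by_contra hne
      have hsep := hS _ (hwk v).1 _ (hwk v').1 hne
      have : dist (wk v) (wk v') ≤ 2 * η :=
        calc dist (wk v) (wk v') ≤ dist (w v) (wk v) + dist (w v) (wk v') := dist_triangle_left _ _ _
          _ ≤ η + η := by
              gcongr
              · exact hw_dist v
              · rw [h2]; exact hw_dist v'
          _ = 2 * η := by ring
      linarith
    have h4 : (e.symm ⟨A v, hAmem v⟩ : ↥Tk) = e.symm ⟨A v', hAmem v'⟩ := by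
      apply Subtype.ext
      rw [← hwk_eq v, ← hwk_eq v', h3]
    have h5 := e.symm.injective h4
    have h6 : A v = A v' := congrArg Subtype.val h5
    exact Subtype.ext (A.injective h6)
  · intro v
    show dist (a⁻¹ • (w v - y)) (A v) ≤ 1 / 5 + 2 * η / a
    have hd1 : dist (a⁻¹ • (w v - y)) (a⁻¹ • (wk v - p)) ≤ 2 * η / a := by
      rw [dist_smul₀, norm_inv, Real.norm_of_nonneg ha.le, dist_eq_norm]
      have hnum : ‖(w v - y) - (wk v - p)‖ ≤ 2 * η := by
        have hrew : (w v - y) - (wk v - p) = (w v - wk v) + (p - y) := by abel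
        rw [hrew]
        have ha1 : ‖w v - wk v‖ ≤ η := by rw [← dist_eq_norm]; exact hw_dist v
        have ha2 : ‖p - y‖ ≤ η := by rw [← dist_eq_norm, dist_comm]; exact hyp
        calc ‖(w v - wk v) + (p - y)‖ ≤ ‖w v - wk v‖ + ‖p - y‖ := norm_add_le _ _
          _ ≤ η + η := add_le_add ha1 ha2
          _ = 2 * η := by ring
      calc a⁻¹ * ‖(w v - y) - (wk v - p)‖ ≤ a⁻¹ * (2 * η) := by gcongr
        _ = 2 * η / a := by ring
    have hd2 : dist (a⁻¹ • (wk v - p)) (A v) ≤ 1 / 5 := by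
      rw [hwk_eq v]
      have := he (e.symm ⟨A v, hAmem v⟩)
      rwa [Equiv.apply_symm_apply] at this
    calc dist (a⁻¹ • (w v - y)) (A v)
        ≤ dist (a⁻¹ • (w v - y)) (a⁻¹ • (wk v - p)) + dist (a⁻¹ • (wk v - p)) (A v) :=
          dist_triangle _ _ _
      _ ≤ 2 * η / a + 1 / 5 := add_le_add hd1 hd2
      _ = 1 / 5 + 2 * η / a := by ring

/-- CLEAN (typed) SITES ARE CLOSED: the twelve shell points converge (collar transfer gives the
bijections), one of the finitely many labellings `pattern → shell` recurs (pigeonhole,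
`exists_frequently_eq_of_forall_mem`), the isometries converge along a subsequence
(`exists_subseq_tendsto_linearIsometry`, tree), and `≤ 1/5` passes to the limit. Hypothesis `hclC`
of the schema for `Clean := CleanSite a`. PROVED. -/
theorem cleanSite_of_tendsto {S : ℕ → LocalConfig E3} {Y : LocalConfig E3} {a δ : ℝ}
    (ha : 0 < a) (hδ : 0 < δ) (hS : ∀ k, ∀ u ∈ S k, ∀ v ∈ S k, u ≠ v → δ ≤ dist u v)
    (hY : Tendsto S atTop (𝓝 Y)) {y : E3} {r : ℝ} (hy : y ∈ Y) (hyr : ‖y‖ < r)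
    (hgood : ∀ᶠ k in atTop, ∀ p ∈ S k, ‖p‖ ≤ r → CleanSite a (S k : Set E3) p) :
    CleanSite a (Y : Set E3) y := by
  classical
  have hgoodG : ∀ᶠ k in atTop, ∀ p ∈ S k, ‖p‖ ≤ r → GappedTwelve a (S k : Set E3) p :=
    hgood.mono fun k hk p hp hpr => (hk p hp hpr).1
  have hGY : GappedTwelve a (Y : Set E3) y := gappedTwelve_of_tendsto ha hδ hS hY hy hyr hgoodG
  have hrad := radial_of_tendsto ha hδ hS hY hy hyr hgoodG
  refine ⟨hGY, ?_⟩
  -- the limit shell as a `Finset` of twelve points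
  have hfin : {w ∈ (Y : Set E3) | w ≠ y ∧ dist y w ≤ a * (1 + 1 / 50)}.Finite :=
    Set.finite_of_ncard_ne_zero (by rw [hGY.1]; norm_num)
  have hfinT := hfin.image (fun w => a⁻¹ • (w - y))
  have hresc_inj : Function.Injective fun w : E3 => a⁻¹ • (w - y) := fun u v huv =>
    sub_left_injective (smul_right_injective E3 (inv_ne_zero ha.ne') huv)
  have hT : (↑hfinT.toFinset : Set E3) =
      (fun w => a⁻¹ • (w - y)) '' {w ∈ (Y : Set E3) | w ≠ y ∧ dist y w ≤ a * (1 + 1 / 50)} :=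
    hfinT.coe_toFinset
  have hTcard : hfinT.toFinset.card = 12 := by
    rw [← Set.ncard_coe_finset, hT, Set.ncard_image_of_injective _ hresc_inj, hGY.1]
  refine ⟨hfinT.toFinset, hT, ?_⟩
  -- matching scales `ηs n → 0`
  have hr : 0 < r - ‖y‖ := by linarith
  set η₀ : ℝ := min (δ / 4) (min (a / 50) (min ((r - ‖y‖) / 2) 1)) with hη₀_def
  have hη₀ : 0 < η₀ := lt_min (by positivity) (lt_min (by positivity) (lt_min (by positivity) one_pos))
  have hη₀δ : η₀ ≤ δ / 4 := min_le_left _ _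
  have hη₀a : η₀ ≤ a / 50 := (min_le_right _ _).trans (min_le_left _ _)
  have hη₀r : η₀ ≤ (r - ‖y‖) / 2 := ((min_le_right _ _).trans (min_le_right _ _)).trans (min_le_left _ _)
  have hη₀1 : η₀ ≤ 1 := ((min_le_right _ _).trans (min_le_right _ _)).trans (min_le_right _ _)
  set ηs : ℕ → ℝ := fun n => η₀ * (1 / ((n : ℝ) + 1)) with hηs_def
  have hηs_pos : ∀ n, 0 < ηs n := fun n => by positivity
  have hηs_le : ∀ n, ηs n ≤ η₀ := fun n => by
    have h1 : 1 / ((n : ℝ) + 1) ≤ 1 := by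
      rw [div_le_one (by positivity)]
      linarith [(Nat.cast_nonneg n : (0 : ℝ) ≤ n)]
    calc ηs n = η₀ * (1 / ((n : ℝ) + 1)) := rfl
      _ ≤ η₀ * 1 := by gcongr
      _ = η₀ := mul_one _
  have hεlim : Tendsto (fun n => 2 * ηs n / a) atTop (𝓝 0) := by
    have h := (tendsto_one_div_add_atTop_nhds_zero_nat).const_mul (2 * η₀ / a)
    rw [mul_zero] at h
    refine h.congr fun n => ?_
    simp only [hηs_def]
    ring
  -- stage data at every `n`: an injective labelling of the limit shell by a pattern, for fcc or hcp
  have hstage : ∀ n : ℕ,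
      (∃ (g : ↥fccKissingPattern → ↥hfinT.toFinset) (A : E3 →ₗᵢ[ℝ] E3), Function.Injective g ∧
        ∀ v, dist ((g v : ↥hfinT.toFinset) : E3) (A v) ≤ 1 / 5 + 2 * ηs n / a) ∨
      (∃ (g : ↥hcpKissingPattern → ↥hfinT.toFinset) (A : E3 →ₗᵢ[ℝ] E3), Function.Injective g ∧
        ∀ v, dist ((g v : ↥hfinT.toFinset) : E3) (A v) ≤ 1 / 5 + 2 * ηs n / a) := by
    intro n
    obtain ⟨k, hmatch, hgk⟩ :=
      (((LocalConfig.tendsto_iff_locallyMatches.1 hY) (‖y‖ + 1 + 2 * a) (ηs n) (hηs_pos n)).and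
        hgood).exists
    obtain ⟨p, hp, hyp⟩ := hmatch.2 y hy (by linarith)
    have hpn : ‖p‖ ≤ ‖y‖ + ηs n := by
      have h1 := norm_sub_norm_le p y
      rw [← dist_eq_norm, dist_comm] at h1
      linarith
    have hclean : CleanSite a (S k : Set E3) p := hgk p hp (by linarith [hηs_le n])
    obtain ⟨hgp, Tk, hTk, hclose⟩ := hclean
    have h2η : 2 * ηs n < δ := by linarith [hηs_le n]
    have h25 : 25 * ηs n < a := by linarith [hηs_le n]
    rcases hclose with hf | hh
    · exact Or.inl (stage_labelling ha hδ (hηs_pos n).le h2η h25 ((hηs_le n).trans hη₀1) (hS k)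
        hmatch hp hyp le_rfl hgp hrad hT hTk hf)
    · exact Or.inr (stage_labelling ha hδ (hηs_pos n).le h2η h25 ((hηs_le n).trans hη₀1) (hS k)
        hmatch hp hyp le_rfl hgp hrad hT hTk hh)
  -- one of the two patterns occurs frequently
  have hfreq : (∃ᶠ n in atTop, ∃ (g : ↥fccKissingPattern → ↥hfinT.toFinset) (A : E3 →ₗᵢ[ℝ] E3),
        Function.Injective g ∧ ∀ v, dist ((g v : ↥hfinT.toFinset) : E3) (A v) ≤ 1 / 5 + 2 * ηs n / a) ∨
      (∃ᶠ n in atTop, ∃ (g : ↥hcpKissingPattern → ↥hfinT.toFinset) (A : E3 →ₗᵢ[ℝ] E3),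
        Function.Injective g ∧ ∀ v, dist ((g v : ↥hfinT.toFinset) : E3) (A v) ≤ 1 / 5 + 2 * ηs n / a) := by
    by_contra hcon
    obtain ⟨h1, h2⟩ := not_or.1 hcon
    rw [not_frequently] at h1 h2
    obtain ⟨n, hn1, hn2⟩ := (h1.and h2).exists
    rcases hstage n with h | h
    · exact hn1 h
    · exact hn2 h
  rcases hfreq with h | h
  · exact Or.inl (shellCloseTo_of_frequently (by rw [hTcard, card_fccKissingPattern]) hεlim h)
  · exact Or.inr (shellCloseTo_of_frequently (by rw [hTcard, card_hcpKissingPattern]) hεlim h)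

/-! ## Consistency check: the schema instance has the crux's conclusion shape -/

/-- `CleanSite a Y y` is, definitionally, the per-site conjunct of `CleanLocalLimit`. -/
example (a : ℝ) (Y : Set E3) (y : E3) :
    CleanSite a Y y ↔
      (({w ∈ Y | w ≠ y ∧ dist y w ≤ a * (1 + 1 / 50)}.ncard = 12 ∧
        ∀ w ∈ Y, w ≠ y → a * (1 - 1 / 50) ≤ dist y w ∧
          (dist y w ≤ a * (1 + 1 / 50) ∨ a * (63 / 50) ≤ dist y w)) ∧
      ∃ T : Finset E3, (↑T : Set E3) = (fun w => a⁻¹ • (w - y)) '' {w ∈ Y | w ≠ y ∧ dist y w ≤ a * (1 + 1 / 50)} ∧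
        (ShellCloseTo (1 / 5) T fccKissingPattern ∨ ShellCloseTo (1 / 5) T hcpKissingPattern)) :=
  Iff.rfl

/-! ## Instance lemmas (prover-side bonus): covariance, index ↔ point, counting -/

/-- The bond shell of a re-rooted configuration is the re-rooted bond shell. -/
theorem shell_translate (a : ℝ) (Y : Set E3) (y v : E3) :
    {w ∈ (fun w => w - v) '' Y | w ≠ y - v ∧ dist (y - v) w ≤ a * (1 + 1 / 50)} =
      (fun w => w - v) '' {w ∈ Y | w ≠ y ∧ dist y w ≤ a * (1 + 1 / 50)} := by
  ext w'
  constructor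
  · rintro ⟨⟨w, hw, rfl⟩, hne, hd⟩
    exact ⟨w, ⟨hw, fun h => hne (by rw [h]), by rwa [dist_sub_right] at hd⟩, rfl⟩
  · rintro ⟨w, ⟨hw, hne, hd⟩, rfl⟩
    exact ⟨⟨w, hw, rfl⟩, fun h => hne (sub_left_injective h), by rwa [dist_sub_right]⟩

/-- Re-rooting covariance of gapped-twelve (hypothesis `hcovG` of the schema). PROVED. -/
theorem gappedTwelve_translate_iff (a : ℝ) (Y : Set E3) (y v : E3) :
    GappedTwelve a ((fun w => w - v) '' Y) (y - v) ↔ GappedTwelve a Y y := by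
  unfold GappedTwelve
  rw [shell_translate, Set.ncard_image_of_injective _ sub_left_injective]
  refine and_congr Iff.rfl ⟨fun h w hw hne => ?_, fun h => ?_⟩
  · have := h (w - v) ⟨w, hw, rfl⟩ (fun h' => hne (sub_left_injective h'))
    rwa [dist_sub_right] at this
  · rintro _ ⟨w, hw, rfl⟩ hne
    rw [dist_sub_right]
    exact h w hw (fun h' => hne (by rw [h']))

/-- Re-rooting covariance of the typing clause (hypothesis `hcovC`). PROVED. -/
theorem fccHcpShell_translate_iff (a : ℝ) (Y : Set E3) (y v : E3) :
    FccHcpShell a ((fun w => w - v) '' Y) (y - v) ↔ FccHcpShell a Y y := by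
  have hset : (fun w => a⁻¹ • (w - (y - v))) ''
      {w ∈ (fun w => w - v) '' Y | w ≠ y - v ∧ dist (y - v) w ≤ a * (1 + 1 / 50)} =
      (fun w => a⁻¹ • (w - y)) '' {w ∈ Y | w ≠ y ∧ dist y w ≤ a * (1 + 1 / 50)} := by
    rw [shell_translate, Set.image_image]
    congr 1
    funext w
    rw [sub_sub_sub_cancel_right]
  unfold FccHcpShell
  rw [hset]

/-- Re-rooting covariance of clean sites. PROVED. -/
theorem cleanSite_translate_iff (a : ℝ) (Y : Set E3) (y v : E3) :
    CleanSite a ((fun w => w - v) '' Y) (y - v) ↔ CleanSite a Y y :=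
  and_congr (gappedTwelve_translate_iff a Y y v) (fccHcpShell_translate_iff a Y y v)

/-- Index form (the route's `RadialDefectsVanish` clause for particle `i`) ⇒ point form
(`GappedTwelve` on `range z`) for an injective configuration. PROVED. -/
theorem gappedTwelve_range_of_idx {N : ℕ} {z : Fin N → E3} (hz : Function.Injective z) {a : ℝ}
    {i : Fin N}
    (h : (Finset.univ.filter fun j : Fin N => j ≠ i ∧ dist (z i) (z j) ≤ a * (1 + 1 / 50)).card = 12 ∧
      ∀ j : Fin N, j ≠ i → a * (1 - 1 / 50) ≤ dist (z i) (z j) ∧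
        (dist (z i) (z j) ≤ a * (1 + 1 / 50) ∨ a * (63 / 50) ≤ dist (z i) (z j))) :
    GappedTwelve a (Set.range z) (z i) := by
  classical
  obtain ⟨hcard, hrad⟩ := h
  constructor
  · have hset : {w ∈ Set.range z | w ≠ z i ∧ dist (z i) w ≤ a * (1 + 1 / 50)} =
        z '' ↑(Finset.univ.filter fun j : Fin N => j ≠ i ∧ dist (z i) (z j) ≤ a * (1 + 1 / 50)) := by
      ext w
      constructor
      · rintro ⟨⟨j, rfl⟩, hne, hd⟩
        refine ⟨j, ?_, rfl⟩
        simp only [Finset.coe_filter, Finset.mem_univ, true_and, Set.mem_setOf_eq]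
        exact ⟨fun h => hne (by rw [h]), hd⟩
      · rintro ⟨j, hj, rfl⟩
        simp only [Finset.coe_filter, Finset.mem_univ, true_and, Set.mem_setOf_eq] at hj
        exact ⟨⟨j, rfl⟩, fun h => hj.1 (hz h), hj.2⟩
    rw [hset, Set.ncard_image_of_injective _ hz, Set.ncard_coe_finset, hcard]
  · rintro _ ⟨j, rfl⟩ hne
    exact hrad j (fun h => hne (by rw [h]))

/-- COUNTING STEP (ball counting with the hard core): if the bad particles number at most `θN`
frequently for every `θ > 0`, then for every radius `k`, frequently some particle has only good
particles within `k` (shadows of bad particles have at most `(2k/δ + 1)³` members). PROVED. -/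
theorem frequently_exists_good_ball {x : (N : ℕ) → (Fin N → E3)} {δ : ℝ} (hδ : 0 < δ)
    (hsep : ∀ N (i j : Fin N), i ≠ j → δ ≤ dist (x N i) (x N j))
    (good : (N : ℕ) → Fin N → Prop)
    (hRDV : ∀ θ : ℝ, 0 < θ → ∃ᶠ N in atTop, (Nat.card {i : Fin N // ¬ good N i} : ℝ) ≤ θ * N)
    (k : ℝ) (hk : 0 ≤ k) :
    ∃ᶠ N in atTop, ∃ i : Fin N, ∀ j : Fin N, dist (x N j) (x N i) ≤ k → good N j := by
  classical
  set C : ℝ := (2 * k / δ + 1) ^ 3 with hC_def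
  have hC : 0 < C := by positivity
  refine ((hRDV (1 / (2 * C)) (by positivity)).and_eventually (eventually_ge_atTop 1)).mono ?_
  rintro N ⟨hbad, hN1⟩
  by_contra hcon
  push Not at hcon
  choose f hf hfbad using hcon
  have hinj : Function.Injective (x N) := by
    intro i j hij
    by_contra hne
    have := hsep N i j hne
    rw [hij, dist_self] at this
    linarith
  set Bad : Finset (Fin N) := Finset.univ.filter fun j : Fin N => ¬ good N j with hBad_def
  have hBadcard : (Bad.card : ℝ) = Nat.card {i : Fin N // ¬ good N i} := by
    rw [Nat.card_eq_fintype_card, Fintype.card_subtype]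
  -- fibres of `f` are shadows of bad particles: at most `C` members each
  have hfib : ∀ j ∈ Bad, ((Finset.univ.filter fun i : Fin N => f i = j).card : ℝ) ≤ C := by
    intro j _
    have h := card_le_of_separated_of_dist_le
      ((Finset.univ.filter fun i : Fin N => f i = j).image (x N)) (x N j) hδ hk ?_ ?_
    · rw [Finset.card_image_of_injective _ hinj, finrank_euclideanSpace_fin] at h
      exact h
    · intro c hc
      obtain ⟨i, hi, rfl⟩ := Finset.mem_image.1 hc
      have hij : f i = j := (Finset.mem_filter.1 hi).2
      rw [← hij, dist_comm]
      exact hf i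
    · intro c hc d hd hcd
      obtain ⟨i, -, rfl⟩ := Finset.mem_image.1 hc
      obtain ⟨i', -, rfl⟩ := Finset.mem_image.1 hd
      exact hsep N i i' fun h => hcd (by rw [h])
  have hcover : (Finset.univ : Finset (Fin N)) ⊆
      Bad.biUnion fun j => Finset.univ.filter fun i : Fin N => f i = j := by
    intro i _
    rw [Finset.mem_biUnion]
    exact ⟨f i, Finset.mem_filter.2 ⟨Finset.mem_univ _, hfbad i⟩,
      Finset.mem_filter.2 ⟨Finset.mem_univ _, rfl⟩⟩
  have h1 : (N : ℝ) ≤ Bad.card * C := by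
    have h2 := Finset.card_le_card hcover
    rw [Finset.card_univ, Fintype.card_fin] at h2
    have h3 := Finset.card_biUnion_le (s := Bad)
      (t := fun j => Finset.univ.filter fun i : Fin N => f i = j)
    calc (N : ℝ) ≤ ((Bad.biUnion fun j => Finset.univ.filter fun i : Fin N => f i = j).card : ℝ) := by
          exact_mod_cast h2
      _ ≤ ((∑ j ∈ Bad, (Finset.univ.filter fun i : Fin N => f i = j).card : ℕ) : ℝ) := by
          exact_mod_cast h3
      _ = ∑ j ∈ Bad, ((Finset.univ.filter fun i : Fin N => f i = j).card : ℝ) := by push_cast; rfl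
      _ ≤ ∑ j ∈ Bad, C := Finset.sum_le_sum hfib
      _ = Bad.card * C := by rw [Finset.sum_const, nsmul_eq_mul]
  rw [← hBadcard] at hbad
  have hN : (1 : ℝ) ≤ N := by exact_mod_cast hN1
  have h4 : (Bad.card : ℝ) * C ≤ 1 / (2 * C) * N * C := by gcongr
  have h5 : 1 / (2 * C) * N * C = N / 2 := by field_simp
  linarith

/-! ## Card A, crux level: the rooted clean hull element, and the crux by name -/

/-- Card A, the crux through the hull: from the radial statement AT ONE SCALE `a` and the
alphabet-free rationing, a ROOTED, EVERYWHERE-CLEAN member of the hull (counting ⇒ rooted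
re-rootings clean on `B(0,k)`; `CompactSpace (LocalConfig E3)` ⇒ limit `Y₀ ∈ hull`, all
gapped-twelve by closedness; rationing ⇒ `Y₀.translate c_R ∈ hull` clean on `B(0,R)`; second
`tendsto_subseq`, limit in the CLOSED hull). PROVED. -/
theorem exists_clean_rooted_mem_hull (x : (N : ℕ) → (Fin N → E3))
    (hx : ∀ N, IsGroundState lennardJones (x N)) {a : ℝ} (ha : 0 < a)
    (hRDVa : ∀ θ : ℝ, 0 < θ → ∃ᶠ N in atTop,
      (Nat.card {i : Fin N // ¬ ((Finset.univ.filter fun j : Fin N =>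
          j ≠ i ∧ dist (x N i) (x N j) ≤ a * (1 + 1 / 50)).card = 12 ∧
        ∀ j : Fin N, j ≠ i → a * (1 - 1 / 50) ≤ dist (x N i) (x N j) ∧
          (dist (x N i) (x N j) ≤ a * (1 + 1 / 50) ∨ a * (63 / 50) ≤ dist (x N i) (x N j)))} : ℝ)
        ≤ θ * N)
    (hRat : GappedRationing) :
    ∃ Y ∈ hull x, (0 : E3) ∈ Y ∧ ∀ y ∈ Y, CleanSite a (Y : Set E3) y := by
  classical
  obtain ⟨δ, hδ, hsepGS⟩ := LennardJonesMinimalDistance_holds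
  have hsep : ∀ N (i j : Fin N), i ≠ j → δ ≤ dist (x N i) (x N j) :=
    fun N i j h => hsepGS N (x N) (hx N) i j h
  have hinj : ∀ N, Function.Injective (x N) := by
    intro N i j hij
    by_contra hne
    have := hsep N i j hne
    rw [hij, dist_self] at this
    linarith
  have hsepR : ∀ N, ∀ u ∈ Set.range (x N), ∀ v ∈ Set.range (x N), u ≠ v → δ ≤ dist u v := by
    rintro N _ ⟨i, rfl⟩ _ ⟨j, rfl⟩ hne
    exact hsep N i j fun h => hne (by rw [h])
  -- Step 1: good balls of every radius, along a strictly increasing subsequence of particle numbers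
  have hfreq := fun k : ℕ => frequently_exists_good_ball hδ hsep
    (fun N i => (Finset.univ.filter fun j : Fin N =>
        j ≠ i ∧ dist (x N i) (x N j) ≤ a * (1 + 1 / 50)).card = 12 ∧
      ∀ j : Fin N, j ≠ i → a * (1 - 1 / 50) ≤ dist (x N i) (x N j) ∧
        (dist (x N i) (x N j) ≤ a * (1 + 1 / 50) ∨ a * (63 / 50) ≤ dist (x N i) (x N j)))
    hRDVa k (Nat.cast_nonneg k)
  obtain ⟨Nk, hNk, hP⟩ := extraction_forall_of_frequently hfreq
  choose ik hik using hP
  -- Step 2: the rooted re-rootings `Z k`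
  set Z : ℕ → LocalConfig E3 := fun k => (cfg x (Nk k)).translate (x (Nk k) (ik k)) with hZ_def
  have hZroot : ∀ k, (0 : E3) ∈ Z k := fun k =>
    LocalConfig.zero_mem_translate (show x (Nk k) (ik k) ∈ cfg x (Nk k) from ⟨ik k, rfl⟩)
  have hZsep : ∀ k, ∀ u ∈ Z k, ∀ v ∈ Z k, u ≠ v → δ ≤ dist u v := fun k =>
    LocalConfig.separated_translate (S := cfg x (Nk k)) (hsepR (Nk k)) _
  have hZgood : ∀ k, ∀ p ∈ Z k, ‖p‖ ≤ k → GappedTwelve a (Z k : Set E3) p := by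
    intro k p hp hpk
    rw [LocalConfig.mem_translate_iff] at hp
    obtain ⟨j, hj⟩ := hp
    have hdist : dist (x (Nk k) j) (x (Nk k) (ik k)) ≤ k := by
      rw [hj, dist_eq_norm, add_sub_cancel_right]
      exact hpk
    have hg := gappedTwelve_range_of_idx (hinj _) (hik k j hdist)
    have hp' : p = x (Nk k) j - x (Nk k) (ik k) := by rw [hj, add_sub_cancel_right]
    rw [hp']
    change GappedTwelve a ((fun z => z - x (Nk k) (ik k)) '' Set.range (x (Nk k))) _
    exact (gappedTwelve_translate_iff a _ _ _).2 hg
  -- Step 3: first extraction; the limit is a rooted, separated, all-gapped-twelve hull element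
  obtain ⟨Y₀, ψ, hψ, hlim⟩ := CompactSpace.tendsto_subseq Z
  have hlim2 : Tendsto (fun k => (cfg x (Nk (ψ k))).translate (x (Nk (ψ k)) (ik (ψ k)))) atTop
      (𝓝 Y₀) := hlim
  have hY₀hull : Y₀ ∈ hull x :=
    mem_hull_of_tendsto (hNk.comp hψ) (fun k => x (Nk (ψ k)) (ik (ψ k))) hlim2
  have hY₀rs : (0 : E3) ∈ Y₀ ∧ ∀ u ∈ Y₀, ∀ v ∈ Y₀, u ≠ v → δ ≤ dist u v :=
    (LocalConfig.isClosed_setOf_rooted_separated hδ).mem_of_tendsto hlim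
      (Eventually.of_forall fun k => ⟨hZroot _, hZsep _⟩)
  have hY₀good : ∀ y ∈ Y₀, GappedTwelve a (Y₀ : Set E3) y := by
    intro y hy
    refine gappedTwelve_of_tendsto (S := Z ∘ ψ) ha hδ (fun k => hZsep (ψ k)) hlim hy
      (lt_add_one ‖y‖) ?_
    have hev : ∀ᶠ k in atTop, ‖y‖ + 1 ≤ ((ψ k : ℕ) : ℝ) :=
      (tendsto_natCast_atTop_atTop.comp hψ.tendsto_atTop).eventually (eventually_ge_atTop _)
    filter_upwards [hev] with k hk p hp hpr
    exact hZgood (ψ k) p hp (hpr.trans hk)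
  -- Step 4: rationing at every radius, re-rooting inside the hull, second extraction
  have hY₀ne : (Y₀ : Set E3).Nonempty := ⟨0, hY₀rs.1⟩
  have hcentre : ∀ m : ℕ, ∃ c ∈ (Y₀ : Set E3), ∀ y ∈ (Y₀ : Set E3), dist y c ≤ m →
      FccHcpShell a Y₀ y := fun m => hRat Y₀ a ha hY₀ne hY₀good m
  choose c hc hcm using hcentre
  set W : ℕ → LocalConfig E3 := fun m => Y₀.translate (c m) with hW_def
  have hWhull : ∀ m, W m ∈ hull x := fun m => translate_mem_hull hY₀hull _
  have hWroot : ∀ m, (0 : E3) ∈ W m := fun m => LocalConfig.zero_mem_translate (hc m)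
  have hWsep : ∀ m, ∀ u ∈ W m, ∀ v ∈ W m, u ≠ v → δ ≤ dist u v := fun m =>
    LocalConfig.separated_translate hY₀rs.2 _
  have hWclean : ∀ m, ∀ p ∈ W m, ‖p‖ ≤ m → CleanSite a (W m : Set E3) p := by
    intro m p hp hpm
    rw [LocalConfig.mem_translate_iff] at hp
    have hd : dist (p + c m) (c m) ≤ m := by
      rw [dist_eq_norm, add_sub_cancel_right]
      exact hpm
    have h1 : GappedTwelve a Y₀ (p + c m) := hY₀good _ hp
    have h2 : FccHcpShell a Y₀ (p + c m) := hcm m _ hp hd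
    have hp' : p = p + c m - c m := (add_sub_cancel_right _ _).symm
    rw [hp']
    change CleanSite a ((fun z => z - c m) '' (Y₀ : Set E3)) _
    exact (cleanSite_translate_iff a _ _ _).2 ⟨h1, h2⟩
  obtain ⟨Y, ψ', hψ', hlim'⟩ := CompactSpace.tendsto_subseq W
  have hYhull : Y ∈ hull x :=
    (isClosed_hull x).mem_of_tendsto hlim' (Eventually.of_forall fun m => hWhull _)
  have hYrs : (0 : E3) ∈ Y ∧ ∀ u ∈ Y, ∀ v ∈ Y, u ≠ v → δ ≤ dist u v :=
    (LocalConfig.isClosed_setOf_rooted_separated hδ).mem_of_tendsto hlim'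
      (Eventually.of_forall fun m => ⟨hWroot _, hWsep _⟩)
  refine ⟨Y, hYhull, hYrs.1, fun y hy => ?_⟩
  refine cleanSite_of_tendsto (S := W ∘ ψ') ha hδ (fun m => hWsep (ψ' m)) hlim' hy
    (lt_add_one ‖y‖) ?_
  have hev : ∀ᶠ m in atTop, ‖y‖ + 1 ≤ ((ψ' m : ℕ) : ℝ) :=
    (tendsto_natCast_atTop_atTop.comp hψ'.tendsto_atTop).eventually (eventually_ge_atTop _)
  filter_upwards [hev] with m hm p hp hpr
  exact hWclean (ψ' m) p hp (hpr.trans hm)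

/-- Card A assembled: the alphabet-free factor `RadialDefectsVanish → CleanLocalLimit` from the
rooted clean hull element and the dictionary. PROVED. -/
theorem cleanLimitExtraction_via_hull (hRat : GappedRationing) :
    RadialDefectsVanish → CleanLocalLimit := by
  intro hRDV x hx
  obtain ⟨a, ha1, ha2, hθ⟩ := hRDV x hx
  have ha : 0 < a := by linarith
  obtain ⟨Y, hY, h0, hclean⟩ := exists_clean_rooted_mem_hull x hx ha hθ hRat
  obtain ⟨φ, t, hφ, hT⟩ := exists_seq_of_mem_hull hY
  exact ⟨(Y : Set E3), a, ha1, ha2, h0, ⟨φ, fun n => -t n, hφ, cll_clause_of_tendsto hT⟩,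
    fun y hy => hclean y hy⟩

/-! ## Card B — predicate-generic extraction schema (limit-closed, translation-covariant sites), PROVED -/

/-- FIRST LEMMA of card B: the EXTRACTION SCHEMA. For site predicates `Clean ⊆ Good` on point sets
of `ℝ³` that are translation-covariant and SITEWISE CLOSED under local-rubber limits of
`δ`-separated configurations, a radial-defect statement for `Good` and a rationing statement
`Good everywhere ⇒ Clean balls of every radius` give a rooted local limit of re-rooted clusters of
THE GIVEN `x`, clean everywhere — the conclusion is literally the shape of `CleanLocalLimit`.
Instances: `Good := GappedTwelve a`, `Clean := CleanSite a` (card C supplies the two closedness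
hypotheses), and — after the expected `ShellCensus` repair — any `(τ, γ, η, alphabet)` variant.
PROVED (the hypothesis `hCG : Clean ⊆ Good` turned out to be unnecessary). -/
theorem clean_extraction_schema (Good Clean : Set E3 → E3 → Prop)
    (hCG : ∀ Y y, Clean Y y → Good Y y)
    (hcovG : ∀ (Y : Set E3) (y v : E3), Good ((fun w => w - v) '' Y) (y - v) ↔ Good Y y)
    (hcovC : ∀ (Y : Set E3) (y v : E3), Clean ((fun w => w - v) '' Y) (y - v) ↔ Clean Y y)
    {δ : ℝ} (hδ : 0 < δ)
    (hclG : ∀ (S : ℕ → LocalConfig E3) (Y : LocalConfig E3),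
      (∀ k, ∀ u ∈ S k, ∀ v ∈ S k, u ≠ v → δ ≤ dist u v) → Tendsto S atTop (𝓝 Y) →
      ∀ (y : E3) (r : ℝ), y ∈ Y → ‖y‖ < r →
        (∀ᶠ k in atTop, ∀ p ∈ S k, ‖p‖ ≤ r → Good (S k : Set E3) p) → Good (Y : Set E3) y)
    (hclC : ∀ (S : ℕ → LocalConfig E3) (Y : LocalConfig E3),
      (∀ k, ∀ u ∈ S k, ∀ v ∈ S k, u ≠ v → δ ≤ dist u v) → Tendsto S atTop (𝓝 Y) →
      ∀ (y : E3) (r : ℝ), y ∈ Y → ‖y‖ < r →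
        (∀ᶠ k in atTop, ∀ p ∈ S k, ‖p‖ ≤ r → Clean (S k : Set E3) p) → Clean (Y : Set E3) y)
    (x : (N : ℕ) → (Fin N → E3)) (hsep : ∀ N (i j : Fin N), i ≠ j → δ ≤ dist (x N i) (x N j))
    (hRDV : ∀ θ : ℝ, 0 < θ → ∃ᶠ N in atTop,
      (Nat.card {i : Fin N // ¬ Good (Set.range (x N)) (x N i)} : ℝ) ≤ θ * N)
    (hRat : ∀ Y : Set E3, Y.Nonempty → (∀ u ∈ Y, ∀ v ∈ Y, u ≠ v → δ ≤ dist u v) →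
      (∀ y ∈ Y, Good Y y) → ∀ R : ℝ, ∃ c ∈ Y, ∀ y ∈ Y, dist y c ≤ R → Clean Y y) :
    ∃ Y : Set E3, (0 : E3) ∈ Y ∧
      (∃ (φ : ℕ → ℕ) (t : ℕ → E3), StrictMono φ ∧ ∀ R ε : ℝ, 0 < ε → ∀ᶠ n in atTop,
        (∀ y ∈ Y, ‖y‖ ≤ R → ∃ i : Fin (φ n), dist (x (φ n) i + t n) y ≤ ε) ∧
        (∀ i : Fin (φ n), ‖x (φ n) i + t n‖ ≤ R → ∃ y ∈ Y, dist (x (φ n) i + t n) y ≤ ε)) ∧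
      ∀ y ∈ Y, Clean Y y := by
  classical
  have hinj : ∀ N, Function.Injective (x N) := by
    intro N i j hij
    by_contra hne
    have := hsep N i j hne
    rw [hij, dist_self] at this
    linarith
  have hsepR : ∀ N, ∀ u ∈ Set.range (x N), ∀ v ∈ Set.range (x N), u ≠ v → δ ≤ dist u v := by
    rintro N _ ⟨i, rfl⟩ _ ⟨j, rfl⟩ hne
    exact hsep N i j fun h => hne (by rw [h])
  -- Step 1: good balls of every radius along a strictly increasing subsequence
  have hfreq := fun k : ℕ => frequently_exists_good_ball hδ hsep
    (fun N i => Good (Set.range (x N)) (x N i)) hRDV k (Nat.cast_nonneg k)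
  obtain ⟨Nk, hNk, hP⟩ := extraction_forall_of_frequently hfreq
  choose ik hik using hP
  -- Step 2: rooted re-rootings
  set Z : ℕ → LocalConfig E3 := fun k => (cfg x (Nk k)).translate (x (Nk k) (ik k)) with hZ_def
  have hZroot : ∀ k, (0 : E3) ∈ Z k := fun k =>
    LocalConfig.zero_mem_translate (show x (Nk k) (ik k) ∈ cfg x (Nk k) from ⟨ik k, rfl⟩)
  have hZsep : ∀ k, ∀ u ∈ Z k, ∀ v ∈ Z k, u ≠ v → δ ≤ dist u v := fun k =>
    LocalConfig.separated_translate (S := cfg x (Nk k)) (hsepR (Nk k)) _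
  have hZgood : ∀ k, ∀ p ∈ Z k, ‖p‖ ≤ k → Good (Z k : Set E3) p := by
    intro k p hp hpk
    rw [LocalConfig.mem_translate_iff] at hp
    obtain ⟨j, hj⟩ := hp
    have hdist : dist (x (Nk k) j) (x (Nk k) (ik k)) ≤ k := by
      rw [hj, dist_eq_norm, add_sub_cancel_right]
      exact hpk
    have hg : Good (Set.range (x (Nk k))) (x (Nk k) j) := hik k j hdist
    have hp' : p = x (Nk k) j - x (Nk k) (ik k) := by rw [hj, add_sub_cancel_right]
    rw [hp']
    change Good ((fun z => z - x (Nk k) (ik k)) '' Set.range (x (Nk k))) _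
    exact (hcovG _ _ _).2 hg
  -- Step 3: first extraction
  obtain ⟨Y₀, ψ, hψ, hlim⟩ := CompactSpace.tendsto_subseq Z
  have hlim2 : Tendsto (fun k => (cfg x (Nk (ψ k))).translate (x (Nk (ψ k)) (ik (ψ k)))) atTop
      (𝓝 Y₀) := hlim
  have hY₀hull : Y₀ ∈ hull x :=
    mem_hull_of_tendsto (hNk.comp hψ) (fun k => x (Nk (ψ k)) (ik (ψ k))) hlim2
  have hY₀rs : (0 : E3) ∈ Y₀ ∧ ∀ u ∈ Y₀, ∀ v ∈ Y₀, u ≠ v → δ ≤ dist u v :=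
    (LocalConfig.isClosed_setOf_rooted_separated hδ).mem_of_tendsto hlim
      (Eventually.of_forall fun k => ⟨hZroot _, hZsep _⟩)
  have hY₀good : ∀ y ∈ Y₀, Good (Y₀ : Set E3) y := by
    intro y hy
    refine hclG (Z ∘ ψ) Y₀ (fun k => hZsep (ψ k)) hlim y (‖y‖ + 1) hy (lt_add_one _) ?_
    have hev : ∀ᶠ k in atTop, ‖y‖ + 1 ≤ ((ψ k : ℕ) : ℝ) :=
      (tendsto_natCast_atTop_atTop.comp hψ.tendsto_atTop).eventually (eventually_ge_atTop _)
    filter_upwards [hev] with k hk p hp hpr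
    exact hZgood (ψ k) p hp (hpr.trans hk)
  -- Step 4: rationing, re-rooting inside the hull, second extraction
  have hcentre : ∀ m : ℕ, ∃ c ∈ (Y₀ : Set E3), ∀ y ∈ (Y₀ : Set E3), dist y c ≤ m →
      Clean Y₀ y := fun m => hRat Y₀ ⟨0, hY₀rs.1⟩ hY₀rs.2 hY₀good m
  choose c hc hcm using hcentre
  set W : ℕ → LocalConfig E3 := fun m => Y₀.translate (c m) with hW_def
  have hWhull : ∀ m, W m ∈ hull x := fun m => translate_mem_hull hY₀hull _
  have hWroot : ∀ m, (0 : E3) ∈ W m := fun m => LocalConfig.zero_mem_translate (hc m)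
  have hWsep : ∀ m, ∀ u ∈ W m, ∀ v ∈ W m, u ≠ v → δ ≤ dist u v := fun m =>
    LocalConfig.separated_translate hY₀rs.2 _
  have hWclean : ∀ m, ∀ p ∈ W m, ‖p‖ ≤ m → Clean (W m : Set E3) p := by
    intro m p hp hpm
    rw [LocalConfig.mem_translate_iff] at hp
    have hd : dist (p + c m) (c m) ≤ m := by
      rw [dist_eq_norm, add_sub_cancel_right]
      exact hpm
    have h2 : Clean Y₀ (p + c m) := hcm m _ hp hd
    have hp' : p = p + c m - c m := (add_sub_cancel_right _ _).symm
    rw [hp']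
    change Clean ((fun z => z - c m) '' (Y₀ : Set E3)) _
    exact (hcovC _ _ _).2 h2
  obtain ⟨Y, ψ', hψ', hlim'⟩ := CompactSpace.tendsto_subseq W
  have hYhull : Y ∈ hull x :=
    (isClosed_hull x).mem_of_tendsto hlim' (Eventually.of_forall fun m => hWhull _)
  have hYrs : (0 : E3) ∈ Y ∧ ∀ u ∈ Y, ∀ v ∈ Y, u ≠ v → δ ≤ dist u v :=
    (LocalConfig.isClosed_setOf_rooted_separated hδ).mem_of_tendsto hlim'
      (Eventually.of_forall fun m => ⟨hWroot _, hWsep _⟩)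
  have hYclean : ∀ y ∈ Y, Clean (Y : Set E3) y := by
    intro y hy
    refine hclC (W ∘ ψ') Y (fun m => hWsep (ψ' m)) hlim' y (‖y‖ + 1) hy (lt_add_one _) ?_
    have hev : ∀ᶠ m in atTop, ‖y‖ + 1 ≤ ((ψ' m : ℕ) : ℝ) :=
      (tendsto_natCast_atTop_atTop.comp hψ'.tendsto_atTop).eventually (eventually_ge_atTop _)
    filter_upwards [hev] with m hm p hp hpr
    exact hWclean (ψ' m) p hp (hpr.trans hm)
  obtain ⟨φ, t, hφ, hT⟩ := exists_seq_of_mem_hull hYhull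
  exact ⟨(Y : Set E3), hYrs.1, ⟨φ, fun n => -t n, hφ, cll_clause_of_tendsto hT⟩, hYclean⟩

/-! ## NEW (2026-08-17, crux `CleanLimitExtractionR`, stmt-18072) — Card 1: the trichotomy-input factor -/

/-- Every bond at `y` has EXACTLY four common bonded neighbours (TornFree's `≥ 4` and
FiveFoldRationingR's `≤ 4`, with the route's common-neighbour set verbatim). -/
def ExactFour (a : ℝ) (Y : Set E3) (y : E3) : Prop :=
  ∀ v ∈ Y, v ≠ y → dist y v ≤ a * (1 + 1 / 50) →
    {w ∈ Y | w ≠ y ∧ w ≠ v ∧ dist y w ≤ a * (1 + 1 / 50) ∧ dist v w ≤ a * (1 + 1 / 50)}.ncard = 4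

/-- The bond shell of `y` is PAIRWISE RADIALLY ADMISSIBLE (mutual distances of shell points in
`[0.98a, 1.02a] ∪ [1.26a, ∞)`) — automatic in an all-gapped-twelve configuration, and exactly the
third typing hypothesis of `ShellTrichotomy` after rescaling. -/
def ShellAdmissible (a : ℝ) (Y : Set E3) (y : E3) : Prop :=
  ∀ w ∈ Y, w ≠ y → dist y w ≤ a * (1 + 1 / 50) → ∀ w' ∈ Y, w' ≠ y → dist y w' ≤ a * (1 + 1 / 50) →
    w ≠ w' → a * (1 - 1 / 50) ≤ dist w w' ∧ (dist w w' ≤ a * (1 + 1 / 50) ∨ a * (63 / 50) ≤ dist w w')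

/-- In an all-gapped-twelve configuration every shell is admissible (pair clause at the shell
points). PROVED. -/
theorem shellAdmissible_of_forall_gapped {a : ℝ} {Y : Set E3}
    (hgood : ∀ y ∈ Y, GappedTwelve a Y y) (y : E3) : ShellAdmissible a Y y :=
  fun w hw _ _ w' hw' _ _ hww' => (hgood w hw).2 w' hw' (Ne.symm hww')

/-- The rescaled bond shell of a gapped-twelve site with admissible shell, as a `Finset`
satisfying the three typing hypotheses of `ShellTrichotomy` (twelve points, radii in
`[0.98, 1.02]`, admissible mutual distances). -/
theorem rescaledShell_hyps {a : ℝ} (ha : 0 < a) {Y : Set E3} {y : E3}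
    (hg : GappedTwelve a Y y) (hadm : ShellAdmissible a Y y) :
    ∃ T : Finset E3,
      (↑T : Set E3) = (fun w => a⁻¹ • (w - y)) '' {w ∈ Y | w ≠ y ∧ dist y w ≤ a * (1 + 1 / 50)} ∧
      T.card = 12 ∧ (∀ v ∈ T, 1 - 1 / 50 ≤ ‖v‖ ∧ ‖v‖ ≤ 1 + 1 / 50) ∧
      (∀ v ∈ T, ∀ w ∈ T, v ≠ w → 1 - 1 / 50 ≤ dist v w ∧ (dist v w ≤ 1 + 1 / 50 ∨ 63 / 50 ≤ dist v w)) := by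
  classical
  obtain ⟨hcount, hrad⟩ := hg
  have hresc_inj : Function.Injective fun w : E3 => a⁻¹ • (w - y) := fun u v huv =>
    sub_left_injective (smul_right_injective E3 (inv_ne_zero ha.ne') huv)
  have hfin : {w ∈ Y | w ≠ y ∧ dist y w ≤ a * (1 + 1 / 50)}.Finite :=
    Set.finite_of_ncard_ne_zero (by rw [hcount]; norm_num)
  have hfinT := hfin.image (fun w => a⁻¹ • (w - y))
  refine ⟨hfinT.toFinset, hfinT.coe_toFinset, ?_, ?_, ?_⟩
  · rw [← Set.ncard_coe_finset, hfinT.coe_toFinset, Set.ncard_image_of_injective _ hresc_inj,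
      hcount]
  · intro v hv
    rw [Set.Finite.mem_toFinset] at hv
    obtain ⟨w, ⟨hw, hwy, hd⟩, rfl⟩ := hv
    have hlo := (hrad w hw hwy).1
    rw [norm_smul, norm_inv, Real.norm_of_nonneg ha.le, ← dist_eq_norm, dist_comm]
    constructor
    · rw [le_inv_mul_iff₀ ha]; linarith
    · rw [inv_mul_le_iff₀ ha]; linarith
  · intro v hv v' hv' hvv'
    rw [Set.Finite.mem_toFinset] at hv hv'
    obtain ⟨w, ⟨hw, hwy, hd⟩, rfl⟩ := hv
    obtain ⟨w', ⟨hw', hw'y, hd'⟩, rfl⟩ := hv'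
    have hww' : w ≠ w' := fun h => hvv' (by rw [h])
    obtain ⟨h1, h2⟩ := hadm w hw hwy hd w' hw' hw'y hd' hww'
    rw [dist_smul₀, norm_inv, Real.norm_of_nonneg ha.le, dist_sub_right]
    refine ⟨by rw [le_inv_mul_iff₀ ha]; linarith, ?_⟩
    rcases h2 with h | h
    · left; rw [inv_mul_le_iff₀ ha]; linarith
    · right; rw [le_inv_mul_iff₀ ha]; linarith

/-- THE BOOKKEEPING IDENTITY of the repair: the shell-degree of the shell point `a⁻¹ • (v - y)` in
the rescaled shell `T` of `y` (the quantity `ShellTrichotomy` branches on) equals the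
common-neighbour count of the bond `(y, v)` (the quantity `TornFree` / `FiveFoldRationingR`
bound). PROVED. -/
theorem shellDegree_eq_commonNbrs {a : ℝ} (ha : 0 < a) {Y : Set E3} {y : E3} {T : Finset E3}
    (hT : (↑T : Set E3) = (fun w => a⁻¹ • (w - y)) '' {w ∈ Y | w ≠ y ∧ dist y w ≤ a * (1 + 1 / 50)})
    {v : E3} (hv : v ∈ Y) (hvy : v ≠ y) (hdv : dist y v ≤ a * (1 + 1 / 50)) :
    (T.filter fun u => u ≠ a⁻¹ • (v - y) ∧ dist (a⁻¹ • (v - y)) u ≤ 1 + 1 / 50).card =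
      {w ∈ Y | w ≠ y ∧ w ≠ v ∧ dist y w ≤ a * (1 + 1 / 50) ∧
        dist v w ≤ a * (1 + 1 / 50)}.ncard := by
  have hresc_inj : Function.Injective fun w : E3 => a⁻¹ • (w - y) := fun u u' huu' =>
    sub_left_injective (smul_right_injective E3 (inv_ne_zero ha.ne') huu')
  have hdist : ∀ w : E3, dist (a⁻¹ • (v - y)) (a⁻¹ • (w - y)) = a⁻¹ * dist v w := fun w => by
    rw [dist_smul₀, norm_inv, Real.norm_of_nonneg ha.le, dist_sub_right]
  have h1 : (↑(T.filter fun u => u ≠ a⁻¹ • (v - y) ∧ dist (a⁻¹ • (v - y)) u ≤ 1 + 1 / 50) : Set E3) =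
      (fun w => a⁻¹ • (w - y)) ''
        {w ∈ Y | w ≠ y ∧ w ≠ v ∧ dist y w ≤ a * (1 + 1 / 50) ∧ dist v w ≤ a * (1 + 1 / 50)} := by
    apply Set.ext
    intro u
    constructor
    · intro hu
      obtain ⟨huT, hne, hdu⟩ := Finset.mem_filter.1 (Finset.mem_coe.1 hu)
      have huT' : u ∈ (↑T : Set E3) := Finset.mem_coe.2 huT
      rw [hT] at huT'
      obtain ⟨w, ⟨hw, hwy, hdw⟩, rfl⟩ := huT'
      have hdu' : dist (a⁻¹ • (v - y)) (a⁻¹ • (w - y)) ≤ 1 + 1 / 50 := hdu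
      refine ⟨w, ⟨hw, hwy, fun h => hne (by rw [h]), hdw, ?_⟩, rfl⟩
      rw [hdist w, inv_mul_le_iff₀ ha] at hdu'
      exact hdu'
    · rintro ⟨w, ⟨hw, hwy, hwv, hdw, hdvw⟩, rfl⟩
      have hwT : a⁻¹ • (w - y) ∈ (↑T : Set E3) := by rw [hT]; exact ⟨w, ⟨hw, hwy, hdw⟩, rfl⟩
      refine Finset.mem_coe.2 (Finset.mem_filter.2 ⟨Finset.mem_coe.1 hwT,
        fun h => hwv (hresc_inj h), ?_⟩)
      show dist (a⁻¹ • (v - y)) (a⁻¹ • (w - y)) ≤ 1 + 1 / 50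
      rw [hdist w, inv_mul_le_iff₀ ha]
      exact hdvw
  rw [← Set.ncard_coe_finset, h1, Set.ncard_image_of_injective _ hresc_inj]

/-- POINTWISE TYPING (the trichotomy applied at ONE site): a gapped-twelve site with admissible
shell all of whose bonds have exactly four common neighbours has an fcc- or hcp-close rescaled
shell — branches (B) `≥ 5` and (C) `≤ 3` of `ShellTrichotomy` are excluded by the bookkeeping
identity. PROVED. -/
theorem fccHcpShell_of_exactFour (hST : ShellTrichotomy) {a : ℝ} (ha : 0 < a) {Y : Set E3}
    {y : E3} (hg : GappedTwelve a Y y) (hadm : ShellAdmissible a Y y) (h4 : ExactFour a Y y) :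
    FccHcpShell a Y y := by
  obtain ⟨T, hT, hcard, hnorm, hpair⟩ := rescaledShell_hyps ha hg hadm
  refine ⟨T, hT, ?_⟩
  rcases hST T hcard hnorm hpair with hA | hB | ⟨u, hu, h5⟩ | ⟨u, hu, h3⟩
  · exact Or.inl hA
  · exact Or.inr hB
  · exfalso
    have huT : u ∈ (↑T : Set E3) := Finset.mem_coe.2 hu
    rw [hT] at huT
    obtain ⟨v, ⟨hv, hvy, hdv⟩, rfl⟩ := huT
    have h5' : 5 ≤ (T.filter fun u => u ≠ a⁻¹ • (v - y) ∧
        dist (a⁻¹ • (v - y)) u ≤ 1 + 1 / 50).card := h5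
    rw [shellDegree_eq_commonNbrs ha hT hv hvy hdv, h4 v hv hvy hdv] at h5'
    omega
  · exfalso
    have huT : u ∈ (↑T : Set E3) := Finset.mem_coe.2 hu
    rw [hT] at huT
    obtain ⟨v, ⟨hv, hvy, hdv⟩, rfl⟩ := huT
    have h3' : (T.filter fun u => u ≠ a⁻¹ • (v - y) ∧
        dist (a⁻¹ • (v - y)) u ≤ 1 + 1 / 50).card ≤ 3 := h3
    rw [shellDegree_eq_commonNbrs ha hT hv hvy hdv, h4 v hv hvy hdv] at h3'
    omega

/-- THE NEW FACTOR: `ShellTrichotomy → TornFree → FiveFoldRationingR → GappedRationing`.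
TornFree gives `≥ 4` common neighbours for every bond of the all-gapped `Y`, FiveFoldRationingR
gives a centre `c` with `≤ 4` for every bond within `R` of `c`; so every bond there has exactly
four, every shell there is admissible (all sites gapped), and the pointwise typing applies. PROVED. -/
theorem gappedRationing_of_trichotomy (hST : ShellTrichotomy) (hTF : TornFree)
    (hFFR : FiveFoldRationingR) : GappedRationing := by
  intro Y a ha hne hgood R
  have htf : ∀ y ∈ Y, ∀ v ∈ Y, v ≠ y → dist y v ≤ a * (1 + 1 / 50) →
      4 ≤ {w ∈ Y | w ≠ y ∧ w ≠ v ∧ dist y w ≤ a * (1 + 1 / 50) ∧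
        dist v w ≤ a * (1 + 1 / 50)}.ncard :=
    hTF Y a ha hgood
  obtain ⟨c, hc, hle⟩ := hFFR Y a ha hne hgood htf R
  refine ⟨c, hc, fun y hy hyc => ?_⟩
  refine fccHcpShell_of_exactFour hST ha (hgood y hy) (shellAdmissible_of_forall_gapped hgood y) ?_
  intro v hv hvy hdv
  exact le_antisymm (hle y hy hyc v hv hvy hdv) (htf y hy v hv hvy hdv)

/-- **THE CRUX BY NAME — card 1 (`GappedShellCensus.CleanLimitExtractionR`,
stmt-AtomisticToContinuum-18072)**: the checked hull extraction composed with the new factor.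
PROVED, sorry-free, standard axioms (farm audit `proof-of-item … closed: true`). -/
theorem cleanLimitExtractionR_candidate : CleanLimitExtractionR :=
  fun hRDV hST hTF hFFR =>
    cleanLimitExtraction_via_hull (gappedRationing_of_trichotomy hST hTF hFFR) hRDV

/-! ## NEW — Card 2: bond-graph transport (trichotomy INPUT through the limits, OUTPUT pointwise last) -/

/-- SHELL-CLEAN site (card 2's `Clean` predicate, pattern-free and isometry-free): gapped-twelve,
admissible shell, and every bond with exactly four common neighbours — i.e. the rescaled shell
satisfies the HYPOTHESES of `ShellTrichotomy` and NEITHER of its branches (B), (C). -/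
def ShellClean (a : ℝ) (Y : Set E3) (y : E3) : Prop :=
  GappedTwelve a Y y ∧ ShellAdmissible a Y y ∧ ExactFour a Y y

/-- Re-rooting covariance of `ShellAdmissible`. PROVED. -/
theorem shellAdmissible_translate_iff (a : ℝ) (Y : Set E3) (y v : E3) :
    ShellAdmissible a ((fun w => w - v) '' Y) (y - v) ↔ ShellAdmissible a Y y := by
  unfold ShellAdmissible
  constructor
  · intro h w hw hwy hdw w' hw' hw'y hdw' hww'
    have key := h (w - v) ⟨w, hw, rfl⟩ (fun e => hwy (sub_left_injective e))
      (by rwa [dist_sub_right]) (w' - v) ⟨w', hw', rfl⟩ (fun e => hw'y (sub_left_injective e))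
      (by rwa [dist_sub_right]) (fun e => hww' (sub_left_injective e))
    rwa [dist_sub_right] at key
  · rintro h _ ⟨w, hw, rfl⟩ hwy hdw _ ⟨w', hw', rfl⟩ hw'y hdw' hww'
    have hdw₁ : dist y w ≤ a * (1 + 1 / 50) := by simpa only [dist_sub_right] using hdw
    have hdw₂ : dist y w' ≤ a * (1 + 1 / 50) := by simpa only [dist_sub_right] using hdw'
    have key := h w hw (fun e => hwy (by rw [e])) hdw₁ w' hw' (fun e => hw'y (by rw [e])) hdw₂
      (fun e => hww' (by rw [e]))
    simpa only [dist_sub_right] using key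

/-- Re-rooting covariance of `ExactFour`. PROVED. -/
theorem exactFour_translate_iff (a : ℝ) (Y : Set E3) (y v : E3) :
    ExactFour a ((fun w => w - v) '' Y) (y - v) ↔ ExactFour a Y y := by
  unfold ExactFour
  have hset : ∀ u : E3, {w ∈ (fun w => w - v) '' Y | w ≠ y - v ∧ w ≠ u - v ∧
      dist (y - v) w ≤ a * (1 + 1 / 50) ∧ dist (u - v) w ≤ a * (1 + 1 / 50)} =
      (fun w => w - v) '' {w ∈ Y | w ≠ y ∧ w ≠ u ∧ dist y w ≤ a * (1 + 1 / 50) ∧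
        dist u w ≤ a * (1 + 1 / 50)} := by
    intro u
    ext w'
    constructor
    · rintro ⟨⟨w, hw, rfl⟩, hne, hne', hd, hd'⟩
      refine ⟨w, ⟨hw, fun h => hne (by rw [h]), fun h => hne' (by rw [h]), ?_, ?_⟩, rfl⟩
      · simpa only [dist_sub_right] using hd
      · simpa only [dist_sub_right] using hd'
    · rintro ⟨w, ⟨hw, hne, hne', hd, hd'⟩, rfl⟩
      refine ⟨⟨w, hw, rfl⟩, fun h => hne (sub_left_injective h),
        fun h => hne' (sub_left_injective h), ?_, ?_⟩
      · simpa only [dist_sub_right] using hd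
      · simpa only [dist_sub_right] using hd'
  constructor
  · intro h u hu hne hd
    have key := h (u - v) ⟨u, hu, rfl⟩ (fun h' => hne (sub_left_injective h'))
      (by rwa [dist_sub_right])
    rwa [hset u, Set.ncard_image_of_injective _ sub_left_injective] at key
  · rintro h _ ⟨u, hu, rfl⟩ hne hd
    have hd₁ : dist y u ≤ a * (1 + 1 / 50) := by simpa only [dist_sub_right] using hd
    have key := h u hu (fun h' => hne (by rw [h'])) hd₁
    show {w ∈ (fun w => w - v) '' Y | w ≠ y - v ∧ w ≠ u - v ∧
      dist (y - v) w ≤ a * (1 + 1 / 50) ∧ dist (u - v) w ≤ a * (1 + 1 / 50)}.ncard = 4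
    rw [hset u, Set.ncard_image_of_injective _ sub_left_injective]
    exact key

/-- Re-rooting covariance of `ShellClean` (hypothesis `hcovC` of the schema). PROVED. -/
theorem shellClean_translate_iff (a : ℝ) (Y : Set E3) (y v : E3) :
    ShellClean a ((fun w => w - v) '' Y) (y - v) ↔ ShellClean a Y y :=
  and_congr (gappedTwelve_translate_iff a Y y v)
    (and_congr (shellAdmissible_translate_iff a Y y v) (exactFour_translate_iff a Y y v))

/-- COLLAR TRANSFER OF THE SHELL BOND GRAPH (finite, limit-free; card 2's mechanism). Two
`δ`-separated configurations `S`, `S'`, two-way `(R, η)`-matched with `2η < δ`, `25η < a`; `S` is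
shell-clean at `p`, `S'` is gapped-twelve at the matched site `p'`. Then (i) every shell–shell
distance at `p'` is `2η`-close to an ADMISSIBLE number (a shell–shell distance at `p`), (ii) every
bond at `p'` has AT MOST four common neighbours, (iii) and AT LEAST four once the shell of `p'` is
known to be admissible. PROVED. -/
theorem shellClean_transfer {S S' : Set E3} {a δ η R : ℝ} (ha : 0 < a) (hδ : 0 < δ)
    (hη : 0 ≤ η) (h2η : 2 * η < δ) (hηa : 25 * η < a)
    (hS : ∀ u ∈ S, ∀ v ∈ S, u ≠ v → δ ≤ dist u v)
    (hS' : ∀ u ∈ S', ∀ v ∈ S', u ≠ v → δ ≤ dist u v)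
    (hm : LocallyMatches R η S S') {p p' : E3} (hp : p ∈ S) (hp' : p' ∈ S')
    (hpp' : dist p p' ≤ η) (hR : ‖p‖ + 3 * a ≤ R)
    (hclean : ShellClean a S p) (hg' : GappedTwelve a S' p') :
    (∀ w ∈ S', w ≠ p' → dist p' w ≤ a * (1 + 1 / 50) → ∀ w' ∈ S', w' ≠ p' →
        dist p' w' ≤ a * (1 + 1 / 50) → w ≠ w' →
        ∃ d : ℝ, |d - dist w w'| ≤ 2 * η ∧ (a * (1 - 1 / 50) ≤ d ∧
          (d ≤ a * (1 + 1 / 50) ∨ a * (63 / 50) ≤ d))) ∧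
    (∀ v' ∈ S', v' ≠ p' → dist p' v' ≤ a * (1 + 1 / 50) →
        {w ∈ S' | w ≠ p' ∧ w ≠ v' ∧ dist p' w ≤ a * (1 + 1 / 50) ∧
          dist v' w ≤ a * (1 + 1 / 50)}.ncard ≤ 4) ∧
    (ShellAdmissible a S' p' → ∀ v' ∈ S', v' ≠ p' → dist p' v' ≤ a * (1 + 1 / 50) →
        4 ≤ {w ∈ S' | w ≠ p' ∧ w ≠ v' ∧ dist p' w ≤ a * (1 + 1 / 50) ∧
          dist v' w ≤ a * (1 + 1 / 50)}.ncard) := by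
  obtain ⟨⟨hcount, hradS⟩, hadmS, h4S⟩ := hclean
  obtain ⟨hcount', hrad'⟩ := hg'
  have hpp'' : dist p' p ≤ η := by rw [dist_comm]; exact hpp'
  -- VERTEX MAPS: shell of `p` in `S` ↔ shell of `p'` in `S'` (collars at `p'` resp. `p`)
  have hAto : ∀ w ∈ S, w ≠ p → dist p w ≤ a * (1 + 1 / 50) →
      ∃ w' ∈ S', (w' ≠ p' ∧ dist p' w' ≤ a * (1 + 1 / 50)) ∧ dist w w' ≤ η := by
    intro w hwS hwp hdw
    have hwR : ‖w‖ ≤ R := by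
      have h1 := norm_sub_norm_le w p
      rw [← dist_eq_norm, dist_comm] at h1
      nlinarith [ha]
    obtain ⟨w', hw'S, hww'⟩ := hm.2 w hwS hwR
    have hlow : a * (1 - 1 / 50) ≤ dist p w := (hradS w hwS hwp).1
    have hne : w' ≠ p' := by
      intro h
      rw [h] at hww'
      have : dist p w ≤ dist p p' + dist w p' := dist_triangle_right p w p'
      nlinarith [ha]
    have hup : dist p' w' ≤ a * (1 + 1 / 50) + 2 * η :=
      calc dist p' w' ≤ dist p' p + dist p w' := dist_triangle _ _ _
        _ ≤ dist p' p + (dist p w + dist w w') := by gcongr; exact dist_triangle _ _ _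
        _ ≤ η + (a * (1 + 1 / 50) + η) := by gcongr
        _ = a * (1 + 1 / 50) + 2 * η := by ring
    refine ⟨w', hw'S, ⟨hne, ?_⟩, hww'⟩
    rcases (hrad' w' hw'S hne).2 with h | h
    · exact h
    · exfalso; nlinarith [ha]
  have hBto : ∀ w' ∈ S', w' ≠ p' → dist p' w' ≤ a * (1 + 1 / 50) →
      ∃ w ∈ S, (w ≠ p ∧ dist p w ≤ a * (1 + 1 / 50)) ∧ dist w w' ≤ η := by
    intro w' hw'S hw'p hdw'
    have hw'R : ‖w'‖ ≤ R := by
      have h1 := norm_sub_norm_le w' p'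
      rw [← dist_eq_norm, dist_comm] at h1
      have h2 := norm_sub_norm_le p' p
      rw [← dist_eq_norm] at h2
      nlinarith [ha]
    obtain ⟨w, hwS, hww'⟩ := hm.1 w' hw'S hw'R
    have hlow : a * (1 - 1 / 50) ≤ dist p' w' := (hrad' w' hw'S hw'p).1
    have hne : w ≠ p := by
      intro h
      rw [h] at hww'
      have : dist p' w' ≤ dist p' p + dist p w' := dist_triangle _ _ _
      nlinarith [ha]
    have hup : dist p w ≤ a * (1 + 1 / 50) + 2 * η :=
      calc dist p w ≤ dist p p' + dist p' w := dist_triangle _ _ _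
        _ ≤ dist p p' + (dist p' w' + dist w' w) := by gcongr; exact dist_triangle _ _ _
        _ ≤ η + (a * (1 + 1 / 50) + η) := by gcongr; rw [dist_comm]; exact hww'
        _ = a * (1 + 1 / 50) + 2 * η := by ring
    refine ⟨w, hwS, ⟨hne, ?_⟩, hww'⟩
    rcases (hradS w hwS hne).2 with h | h
    · exact h
    · exfalso; nlinarith [ha]
  -- matched pairs: distinct on one side iff distinct on the other (`2η < δ`)
  have hsep_tr : ∀ u ∈ S, ∀ v ∈ S, ∀ u' ∈ S', ∀ v' ∈ S', dist u u' ≤ η → dist v v' ≤ η →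
      (u ≠ v ↔ u' ≠ v') := by
    intro u hu v hv u' hu' v' hv' huu' hvv'
    constructor
    · intro hne heq
      subst heq
      have hsep := hS u hu v hv hne
      have : dist u v ≤ dist u u' + dist v u' := dist_triangle_right _ _ _
      linarith
    · intro hne heq
      subst heq
      have hsep := hS' u' hu' v' hv' hne
      have : dist u' v' ≤ dist u u' + dist u v' := dist_triangle_left _ _ _
      linarith
  refine ⟨?_, ?_, ?_⟩
  · -- (i) approximate admissibility of the shell of `p'`
    intro w₁' hw₁' hw₁'p hd₁ w₂' hw₂' hw₂'p hd₂ hne'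
    obtain ⟨w₁, hw₁S, ⟨hw₁p, hdw₁⟩, hd₁₁⟩ := hBto w₁' hw₁' hw₁'p hd₁
    obtain ⟨w₂, hw₂S, ⟨hw₂p, hdw₂⟩, hd₂₂⟩ := hBto w₂' hw₂' hw₂'p hd₂
    have hne : w₁ ≠ w₂ := (hsep_tr w₁ hw₁S w₂ hw₂S w₁' hw₁' w₂' hw₂' hd₁₁ hd₂₂).2 hne'
    refine ⟨dist w₁ w₂, ?_, hadmS w₁ hw₁S hw₁p hdw₁ w₂ hw₂S hw₂p hdw₂ hne⟩
    rw [abs_sub_le_iff]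
    constructor
    · have := dist_triangle4 w₁ w₁' w₂' w₂
      rw [dist_comm w₂' w₂] at this
      linarith
    · have := dist_triangle4 w₁' w₁ w₂ w₂'
      rw [dist_comm w₁' w₁] at this
      linarith
  · -- (ii) at most four common neighbours: common(p', v') ↪ common(p, v)
    intro v' hv'S hv'p hdv'
    obtain ⟨v, hvS, ⟨hvp, hdv⟩, hvv'⟩ := hBto v' hv'S hv'p hdv'
    have hC : {w ∈ S | w ≠ p ∧ w ≠ v ∧ dist p w ≤ a * (1 + 1 / 50) ∧
        dist v w ≤ a * (1 + 1 / 50)}.ncard = 4 := h4S v hvS hvp hdv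
    have hCfin : {w ∈ S | w ≠ p ∧ w ≠ v ∧ dist p w ≤ a * (1 + 1 / 50) ∧
        dist v w ≤ a * (1 + 1 / 50)}.Finite :=
      Set.finite_of_ncard_ne_zero (by rw [hC]; norm_num)
    have hmap : ∀ w' ∈ {w ∈ S' | w ≠ p' ∧ w ≠ v' ∧ dist p' w ≤ a * (1 + 1 / 50) ∧
        dist v' w ≤ a * (1 + 1 / 50)},
        ∃ w ∈ {w ∈ S | w ≠ p ∧ w ≠ v ∧ dist p w ≤ a * (1 + 1 / 50) ∧
          dist v w ≤ a * (1 + 1 / 50)}, dist w w' ≤ η := by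
      rintro w' ⟨hw'S, hw'p, hw'v, hdpw', hdvw'⟩
      obtain ⟨w, hwS, ⟨hwp, hdpw⟩, hww'⟩ := hBto w' hw'S hw'p hdpw'
      have hwv : w ≠ v := (hsep_tr w hwS v hvS w' hw'S v' hv'S hww' hvv').2 hw'v
      refine ⟨w, ⟨hwS, hwp, hwv, hdpw, ?_⟩, hww'⟩
      have hup : dist v w ≤ a * (1 + 1 / 50) + 2 * η := by
        have := dist_triangle4 v v' w' w
        rw [dist_comm w' w] at this
        linarith
      rcases (hadmS v hvS hvp hdv w hwS hwp hdpw (Ne.symm hwv)).2 with h | h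
      · exact h
      · exfalso; linarith
    choose! g hg using hmap
    have hginj : Set.InjOn g {w ∈ S' | w ≠ p' ∧ w ≠ v' ∧ dist p' w ≤ a * (1 + 1 / 50) ∧
        dist v' w ≤ a * (1 + 1 / 50)} := by
      intro w₁ h₁ w₂ h₂ heq
      by_contra hne
      have hsep := hS' w₁ h₁.1 w₂ h₂.1 hne
      have : dist w₁ w₂ ≤ 2 * η :=
        calc dist w₁ w₂ ≤ dist (g w₁) w₁ + dist (g w₁) w₂ := dist_triangle_left _ _ _
          _ ≤ η + η := by
              gcongr
              · exact (hg w₁ h₁).2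
              · rw [heq]; exact (hg w₂ h₂).2
          _ = 2 * η := by ring
      linarith
    have h1 := Set.ncard_le_ncard_of_injOn g (fun w hw => (hg w hw).1) hginj hCfin
    rw [hC] at h1
    exact h1
  · -- (iii) at least four, given admissibility of the shell of `p'`: common(p, v) ↪ common(p', v')
    intro hadm' v' hv'S hv'p hdv'
    obtain ⟨v, hvS, ⟨hvp, hdv⟩, hvv'⟩ := hBto v' hv'S hv'p hdv'
    have hC : {w ∈ S | w ≠ p ∧ w ≠ v ∧ dist p w ≤ a * (1 + 1 / 50) ∧
        dist v w ≤ a * (1 + 1 / 50)}.ncard = 4 := h4S v hvS hvp hdv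
    have hBfin : {w ∈ S' | w ≠ p' ∧ dist p' w ≤ a * (1 + 1 / 50)}.Finite :=
      Set.finite_of_ncard_ne_zero (by rw [hcount']; norm_num)
    have hC'fin : {w ∈ S' | w ≠ p' ∧ w ≠ v' ∧ dist p' w ≤ a * (1 + 1 / 50) ∧
        dist v' w ≤ a * (1 + 1 / 50)}.Finite :=
      hBfin.subset fun w hw => ⟨hw.1, hw.2.1, hw.2.2.2.1⟩
    have hmap : ∀ w ∈ {w ∈ S | w ≠ p ∧ w ≠ v ∧ dist p w ≤ a * (1 + 1 / 50) ∧
        dist v w ≤ a * (1 + 1 / 50)},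
        ∃ w' ∈ {w ∈ S' | w ≠ p' ∧ w ≠ v' ∧ dist p' w ≤ a * (1 + 1 / 50) ∧
          dist v' w ≤ a * (1 + 1 / 50)}, dist w w' ≤ η := by
      rintro w ⟨hwS, hwp, hwv, hdpw, hdvw⟩
      obtain ⟨w', hw'S, ⟨hw'p, hdpw'⟩, hww'⟩ := hAto w hwS hwp hdpw
      have hw'v : w' ≠ v' := (hsep_tr w hwS v hvS w' hw'S v' hv'S hww' hvv').1 hwv
      refine ⟨w', ⟨hw'S, hw'p, hw'v, hdpw', ?_⟩, hww'⟩
      have hup : dist v' w' ≤ a * (1 + 1 / 50) + 2 * η := by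
        have := dist_triangle4 v' v w w'
        rw [dist_comm v' v] at this
        linarith
      rcases (hadm' v' hv'S hv'p hdv' w' hw'S hw'p hdpw' (Ne.symm hw'v)).2 with h | h
      · exact h
      · exfalso; linarith
    choose! f hf using hmap
    have hfinj : Set.InjOn f {w ∈ S | w ≠ p ∧ w ≠ v ∧ dist p w ≤ a * (1 + 1 / 50) ∧
        dist v w ≤ a * (1 + 1 / 50)} := by
      intro w₁ h₁ w₂ h₂ heq
      by_contra hne
      have hsep := hS w₁ h₁.1 w₂ h₂.1 hne
      have : dist w₁ w₂ ≤ 2 * η :=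
        calc dist w₁ w₂ ≤ dist w₁ (f w₁) + dist w₂ (f w₁) := dist_triangle_right _ _ _
          _ ≤ η + η := by
              gcongr
              · exact (hf w₁ h₁).2
              · rw [heq]; exact (hf w₂ h₂).2
          _ = 2 * η := by ring
      linarith
    have h1 := Set.ncard_le_ncard_of_injOn f (fun w hw => (hf w hw).1) hfinj hC'fin
    rw [hC] at h1
    exact h1

/-- **FIRST LEMMA of card 2: SHELL-CLEAN IS CLOSED under local-rubber limits of `δ`-separated
configurations** (hypothesis `hclC` of the schema for `Clean := ShellClean a`), with NO radius
loss.  Mechanism = `shellClean_transfer` along fine matchings at every scale `η ↓ 0`: gapped-twelve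
by `gappedTwelve_of_tendsto`; admissibility of the limit shell because the admissible set is
closed and every limit shell–shell distance is `2η`-close to an admissible one for every `η`;
exactly four because `≤ 4` transfers down to the limit and, once the limit shell is admissible,
`≥ 4` does too. PROVED. -/
theorem shellClean_of_tendsto {S : ℕ → LocalConfig E3} {Y : LocalConfig E3} {a δ : ℝ}
    (ha : 0 < a) (hδ : 0 < δ) (hS : ∀ k, ∀ u ∈ S k, ∀ v ∈ S k, u ≠ v → δ ≤ dist u v)
    (hY : Tendsto S atTop (𝓝 Y)) {y : E3} {r : ℝ} (hy : y ∈ Y) (hyr : ‖y‖ < r)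
    (hgood : ∀ᶠ k in atTop, ∀ p ∈ S k, ‖p‖ ≤ r → ShellClean a (S k : Set E3) p) :
    ShellClean a (Y : Set E3) y := by
  have hgoodG : ∀ᶠ k in atTop, ∀ p ∈ S k, ‖p‖ ≤ r → GappedTwelve a (S k : Set E3) p :=
    hgood.mono fun k hk p hp hpr => (hk p hp hpr).1
  have hGY : GappedTwelve a (Y : Set E3) y := gappedTwelve_of_tendsto ha hδ hS hY hy hyr hgoodG
  have hYsep : ∀ u ∈ Y, ∀ v ∈ Y, u ≠ v → δ ≤ dist u v :=
    (LocalConfig.isClosed_setOf_separated δ).mem_of_tendsto hY (Eventually.of_forall hS)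
  have hr : 0 < r - ‖y‖ := by linarith
  set η₀ : ℝ := min (δ / 4) (min (a / 50) (min ((r - ‖y‖) / 2) 1)) with hη₀_def
  have hη₀ : 0 < η₀ := lt_min (by positivity) (lt_min (by positivity) (lt_min (by positivity) one_pos))
  have hη₀δ : η₀ ≤ δ / 4 := min_le_left _ _
  have hη₀a : η₀ ≤ a / 50 := (min_le_right _ _).trans (min_le_left _ _)
  have hη₀r : η₀ ≤ (r - ‖y‖) / 2 := ((min_le_right _ _).trans (min_le_right _ _)).trans (min_le_left _ _)
  have hη₀1 : η₀ ≤ 1 := ((min_le_right _ _).trans (min_le_right _ _)).trans (min_le_right _ _)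
  -- stage data at every scale `η ≤ η₀`
  have hstage : ∀ η : ℝ, 0 < η → η ≤ η₀ →
      (∀ w ∈ (Y : Set E3), w ≠ y → dist y w ≤ a * (1 + 1 / 50) → ∀ w' ∈ (Y : Set E3), w' ≠ y →
          dist y w' ≤ a * (1 + 1 / 50) → w ≠ w' →
          ∃ d : ℝ, |d - dist w w'| ≤ 2 * η ∧ (a * (1 - 1 / 50) ≤ d ∧
            (d ≤ a * (1 + 1 / 50) ∨ a * (63 / 50) ≤ d))) ∧
      (∀ v ∈ (Y : Set E3), v ≠ y → dist y v ≤ a * (1 + 1 / 50) →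
          {w ∈ (Y : Set E3) | w ≠ y ∧ w ≠ v ∧ dist y w ≤ a * (1 + 1 / 50) ∧
            dist v w ≤ a * (1 + 1 / 50)}.ncard ≤ 4) ∧
      (ShellAdmissible a (Y : Set E3) y → ∀ v ∈ (Y : Set E3), v ≠ y →
          dist y v ≤ a * (1 + 1 / 50) →
          4 ≤ {w ∈ (Y : Set E3) | w ≠ y ∧ w ≠ v ∧ dist y w ≤ a * (1 + 1 / 50) ∧
            dist v w ≤ a * (1 + 1 / 50)}.ncard) := by
    intro η hη hηle
    have hηδ : η ≤ δ / 4 := hηle.trans hη₀δ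
    have hηa : η ≤ a / 50 := hηle.trans hη₀a
    have hηr : η ≤ (r - ‖y‖) / 2 := hηle.trans hη₀r
    have hη1 : η ≤ 1 := hηle.trans hη₀1
    obtain ⟨k, hmatch, hgk⟩ :=
      (((LocalConfig.tendsto_iff_locallyMatches.1 hY) (‖y‖ + 1 + 3 * a) η hη).and hgood).exists
    obtain ⟨p, hp, hyp⟩ := hmatch.2 y hy (by linarith)
    have hpn : ‖p‖ ≤ ‖y‖ + η := by
      have h1 := norm_sub_norm_le p y
      rw [← dist_eq_norm, dist_comm] at h1
      linarith
    have hclean : ShellClean a (S k : Set E3) p := hgk p hp (by linarith)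
    exact shellClean_transfer ha hδ hη.le (by linarith) (by linarith) (hS k) hYsep hmatch.symm hp hy
      (by rw [dist_comm]; exact hyp) (by linarith) hclean hGY
  -- admissibility of the limit shell: the admissible set is closed
  have hadmY : ShellAdmissible a (Y : Set E3) y := by
    intro w hw hwy hdw w' hw' hw'y hdw' hww'
    have key : ∀ η : ℝ, 0 < η → η ≤ η₀ → ∃ d : ℝ, |d - dist w w'| ≤ 2 * η ∧
        (a * (1 - 1 / 50) ≤ d ∧ (d ≤ a * (1 + 1 / 50) ∨ a * (63 / 50) ≤ d)) :=
      fun η hη hηle => (hstage η hη hηle).1 w hw hwy hdw w' hw' hw'y hdw' hww'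
    constructor
    · by_contra hlt
      push Not at hlt
      obtain ⟨d, hd, hd1, -⟩ := key (min η₀ ((a * (1 - 1 / 50) - dist w w') / 4))
        (lt_min hη₀ (by linarith)) (min_le_left _ _)
      have hle : min η₀ ((a * (1 - 1 / 50) - dist w w') / 4) ≤ (a * (1 - 1 / 50) - dist w w') / 4 :=
        min_le_right _ _
      obtain ⟨h1, h2⟩ := abs_sub_le_iff.1 hd
      linarith
    · by_contra hcon
      push Not at hcon
      obtain ⟨hgt, hlt⟩ := hcon
      obtain ⟨d, hd, -, hd2⟩ := key (min η₀ (min ((dist w w' - a * (1 + 1 / 50)) / 4)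
          ((a * (63 / 50) - dist w w') / 4)))
        (lt_min hη₀ (lt_min (by linarith) (by linarith))) (min_le_left _ _)
      have e1 : min η₀ (min ((dist w w' - a * (1 + 1 / 50)) / 4) ((a * (63 / 50) - dist w w') / 4)) ≤
          (dist w w' - a * (1 + 1 / 50)) / 4 := (min_le_right _ _).trans (min_le_left _ _)
      have e2 : min η₀ (min ((dist w w' - a * (1 + 1 / 50)) / 4) ((a * (63 / 50) - dist w w') / 4)) ≤
          (a * (63 / 50) - dist w w') / 4 := (min_le_right _ _).trans (min_le_right _ _)
      obtain ⟨h1, h2⟩ := abs_sub_le_iff.1 hd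
      rcases hd2 with h | h
      · linarith
      · linarith
  refine ⟨hGY, hadmY, fun v hv hvy hdv => ?_⟩
  obtain ⟨-, hup, hlow⟩ := hstage η₀ hη₀ le_rfl
  exact le_antisymm (hup v hv hvy hdv) (hlow hadmY v hv hvy hdv)

/-- Card 2's rationing instance (hypothesis `hRat` of the schema for `Clean := ShellClean a`),
from TornFree (`≥ 4` everywhere) and FiveFoldRationingR (`≤ 4` on balls of every radius); the
admissibility conjunct is automatic in an all-gapped configuration. PROVED — no census used. -/
theorem shellCleanRationing_of_cruxes (hTF : TornFree) (hFFR : FiveFoldRationingR) {a δ : ℝ}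
    (ha : 0 < a) :
    ∀ Y : Set E3, Y.Nonempty → (∀ u ∈ Y, ∀ v ∈ Y, u ≠ v → δ ≤ dist u v) →
      (∀ y ∈ Y, GappedTwelve a Y y) → ∀ R : ℝ, ∃ c ∈ Y, ∀ y ∈ Y, dist y c ≤ R →
        ShellClean a Y y := by
  intro Y hne _ hgood R
  have htf : ∀ y ∈ Y, ∀ v ∈ Y, v ≠ y → dist y v ≤ a * (1 + 1 / 50) →
      4 ≤ {w ∈ Y | w ≠ y ∧ w ≠ v ∧ dist y w ≤ a * (1 + 1 / 50) ∧
        dist v w ≤ a * (1 + 1 / 50)}.ncard :=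
    hTF Y a ha hgood
  obtain ⟨c, hc, hle⟩ := hFFR Y a ha hne hgood htf R
  exact ⟨c, hc, fun y hy hyc => ⟨hgood y hy, shellAdmissible_of_forall_gapped hgood y,
    fun v hv hvy hdv => le_antisymm (hle y hy hyc v hv hvy hdv) (htf y hy v hv hvy hdv)⟩⟩

/-- **THE CRUX BY NAME — card 2**: `clean_extraction_schema` (PROVED above) instantiated with
`Good := GappedTwelve a`, `Clean := ShellClean a`; the trichotomy enters only in the last line,
pointwise (`fccHcpShell_of_exactFour`). PROVED, sorry-free, standard axioms. -/
theorem cleanLimitExtractionR_via_counts : CleanLimitExtractionR := by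
  intro hRDV hST hTF hFFR x hx
  classical
  obtain ⟨a, ha1, ha2, hθ⟩ := hRDV x hx
  have ha : 0 < a := by linarith
  obtain ⟨δ, hδ, hsepGS⟩ := LennardJonesMinimalDistance_holds
  have hsep : ∀ N (i j : Fin N), i ≠ j → δ ≤ dist (x N i) (x N j) :=
    fun N i j h => hsepGS N (x N) (hx N) i j h
  have hinj : ∀ N, Function.Injective (x N) := by
    intro N i j hij
    by_contra hne
    have := hsep N i j hne
    rw [hij, dist_self] at this
    linarith
  -- RDV's index clause implies `GappedTwelve a` on `range (x N)`, so the bad set only shrinks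
  have hRDV' : ∀ θ : ℝ, 0 < θ → ∃ᶠ N in atTop,
      (Nat.card {i : Fin N // ¬ GappedTwelve a (Set.range (x N)) (x N i)} : ℝ) ≤ θ * N := by
    intro θ hθpos
    refine (hθ θ hθpos).mono fun N hN => le_trans ?_ hN
    have hle : Nat.card {i : Fin N // ¬ GappedTwelve a (Set.range (x N)) (x N i)} ≤
        Nat.card {i : Fin N // ¬ ((Finset.univ.filter fun j : Fin N =>
            j ≠ i ∧ dist (x N i) (x N j) ≤ a * (1 + 1 / 50)).card = 12 ∧
          ∀ j : Fin N, j ≠ i → a * (1 - 1 / 50) ≤ dist (x N i) (x N j) ∧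
            (dist (x N i) (x N j) ≤ a * (1 + 1 / 50) ∨ a * (63 / 50) ≤ dist (x N i) (x N j)))} := by
      rw [Nat.card_eq_fintype_card, Nat.card_eq_fintype_card]
      exact Fintype.card_subtype_mono _ _ fun i hi hidx =>
        hi (gappedTwelve_range_of_idx (hinj N) hidx)
    exact_mod_cast hle
  obtain ⟨Y, h0, hmatch, hclean⟩ := clean_extraction_schema (GappedTwelve a) (ShellClean a)
    (fun Y y h => h.1) (gappedTwelve_translate_iff a) (shellClean_translate_iff a) hδ
    (fun S Y hS hY y r hy hyr hgood => gappedTwelve_of_tendsto ha hδ hS hY hy hyr hgood)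
    (fun S Y hS hY y r hy hyr hgood => shellClean_of_tendsto ha hδ hS hY hy hyr hgood)
    x hsep hRDV' (shellCleanRationing_of_cruxes hTF hFFR ha)
  refine ⟨Y, a, ha1, ha2, h0, hmatch, fun y hy => ?_⟩
  obtain ⟨hg, hadm, h4⟩ := hclean y hy
  exact ⟨hg, fccHcpShell_of_exactFour hST ha hg hadm h4⟩


end Summit.AtomisticToContinuum.Crystallization.Cruxes.CleanLimitExtractionR.IdeatorTwo

end
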